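import Literature.NumberTheory.EllipticCurves.FunctionFieldLPoints
import HarnessLib

/-!
# The polar degree of an `L`-point and its parallelogram law

Trunk T-ELLARITH (group G16); notion `cm_endomorphisms_isogeny`. Third layer (after
`WeierstrassPlaces` and `FunctionFieldLPoints`) of the divisor-theoretic degree route to the
named fact `Literature.AlgebraicGeometry.Motives.linearIndependent_tateModule_map` (Silverman, *AEC*, Thm. III.7.4).
For Weierstrass curves `V, V'` with non-zero discriminant over an algebraically closed field `k`,
`L = k(V)`, and `L`-points `A, B` of `V'` (points of the base change of `V'` to `L`), it

* proves the local rules of the group law of `V'(L)` under specialisation at a place `P` of `L`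
  (the elementary part of "reduction modulo `P` is a homomorphism", *AEC* VII.2.1, by valuation
  estimates on the chord-and-tangent formulae of *AEC* III.2.3);
* defines the **polar degree** `d(X) = Σ_{X(P) = O'} e_X(P)` of an `L`-point `X` (the degree of
  the morphism `V → V'` that `X` is, *AEC* II.2.6(a); for the generic image of an isogeny `φ` it
  is `deg φ`, see `IsogenyPolarDegree`);
* proves the **parallelogram law** `d(A + B) + d(A - B) = 2d(A) + 2d(B)` for `A, B` each `O` or
  affine with non-constant `x`-coordinate (`polarDeg_parallelogram`). For isogenies this is *AEC*
  Cor. III.6.3 (`deg` is a quadratic form), proved there through the dual isogeny; the present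
  proof counts poles instead.

## The argument

*Generic pairs.* Let `A = (u_A, w_A)`, `B = (u_B, w_B)` with `u_A ≠ u_B` and put
`w = u_A - u_B ∈ L`. At a place `P`: if `A(P) = O'` (so `v_P(u_A) = exp 2e_A(P)`,
`placeValuation_eq_exp_ramificationIdx`) and `B` is integral, then `ord_P(w) = -2e_A(P)` and
`A ± B` are integral at `P` (`addX_sub_le`: the chord through an integral point and a pole
reduces to the integral point's `x`-coordinate); if both are integral with distinct reduced `x`,
then `ord_P(w) = 0` and `A ± B` are integral (integral slope); if both are integral with the same
reduced `x` and `B(P) ∉ V'[2]`, then exactly one of `A - B`, `A + B` has a pole at `P`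
(`unit_dichotomy`), of ramification `ord_P(w)` (`addX_sub_eq`, from the chord identity
`addX_sub_mul_sq`, whose dominant term is `-y₂(2y₁ + a₁x₁ + a₃)`). Hence the pointwise identity
`ord_P(w) = -2ε_A(P) - 2ε_B(P) + ε_{A+B}(P) + ε_{A-B}(P)` (`ord_sub_eq_poleIdx`), and summing
over `P` with `Σ_P ord_P(w) = 0` (`WeierstrassPlaces.finsum_ord`) gives the law under the
genericity hypotheses (`polarDeg_parallelogram_of_generic`).

*All pairs.* Replace `B` by `B' = B + R_L` for a constant point `R ∈ V'(k)`: the genericity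
hypotheses for `(A, B')` exclude finitely many `R` (`exists_generic_point`: fibres of `A` are
finite, `V'[2]` is finite, `R ↦ R_L` is injective) while `V'(k)` is infinite, and
**`d(X + R_L) = d(X)`** for `R ∉ V'[2]` (`polarDeg_add_constL`; pointwise
`ε_{X+R_L}(P) = e_X(P)·[X(P) = -R]` by the local rules and
`ord_P(x(X) - x(R)) = e_X(P) ord_{-R}(x' - x(R)) = e_X(P)`, so `d(X + R_L) = D_X(-R) = D_X(O')`
by the constancy of the fibre degree, `FunctionFieldLPoints.fibreDegree_eq_fibreDegree_zero`).

## Contents (all definitions are real)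

* Generic valuation lemmas for a Weierstrass curve with `v`-integral coefficients
  (`IntegralCoeff`): `addX_sub_mul_sq`, `addX_sub_le`, `addX_sub_eq`, `sub_mul_eq_sub_mul`,
  `slope_le_one_of_sub_eq_one`, `one_lt_slope_of_opposite`, `slope_le_one_of_tangent`,
  `unit_dichotomy`.
* At a place of `L = k(V)`: `placeValuation_eq_exp_ramificationIdx`,
  **`poleIdx V V' P X = ε_X(P)`** (`e_X(P)` if `X(P) = O'`, else `0`), `poleIdx_add_of_pole`,
  `poleIdx_add_of_sub_eq_one`, `specialize_add_of_opposite`, `poleIdx_add_of_tangent`,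
  `ord_sub_of_eq_add_pole`, **`ord_sub_eq_poleIdx`**; **`polarDeg V V' X = d(X)`**,
  `finsum_poleIdx` (`Σ_P ε_X(P) = d(X)`), **`polarDeg_parallelogram_of_generic`**.
* Residues of chords (`placeValuation_slope_le_one_and_placeRes`, `…addX…`, `…addY…`),
  **`specialize_add_of_sub_eq_one`** (specialisation is additive where both points are integral
  with distinct reduced `x`; *AEC* VII.2.1); **`constL V V' R = R_L`** (`constL_neg`,
  `constL_injective`, `specialize_constL`, `polarDeg_constL`); `ord_xSubC_eq_one`;
  `poleIdx_add_constL`, **`polarDeg_add_constL`**, `polarDeg_neg`; `exists_generic_point`,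
  **`polarDeg_parallelogram`**.

## References

* [SilvermanAEC2009] J. H. Silverman, *The Arithmetic of Elliptic Curves*, 2nd ed., GTM 106,
  Springer 2009: III.2.3 (group law algorithm), II.§2 (ramification, Prop. II.2.6), II.3.5
  (`div (x - e)`), III.6.2–6.3 (`deg` is a positive definite quadratic form), VII.§2
  (Prop. VII.2.1).

## Design choices

* Generic over `k`; `[IsAlgClosed k]` only where fibres are summed. The generic valuation lemmas
  take `[DecidableEq L]` explicitly (Mathlib's `slope` and the group law depend on it) so that
  they apply to `L = k(V)` with its own instance.
* `poleIdx` and `polarDeg` are total functions on `V'(L)` (`0` on `O` and on constant points),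
  so that `Σ_P ε_X(P) = d(X)` holds for every `X` (`finsum_poleIdx`).
-/

noncomputable section

open scoped Classical WithZero AddSubgroup
open scoped Polynomial.Bivariate
open Polynomial IsDedekindDomain

universe u

namespace Literature.NumberTheory.EllipticCurves.WeierstrassFunctionField

open WeierstrassCurve

variable {k : Type u} [Field k]

/-! ## An identity for the chord -/

/-- **The chord identity**: for points `(x₁, y₁)`, `(x₂, y₂)` with `x₁ ≠ x₂` on a Weierstrass
curve and `x₃` the `x`-coordinate of their sum, `(x₃ - x₁)(x₁ - x₂)² =`
`-x₁³ + 3x₁²x₂ + 2a₂x₁x₂ + a₄(x₁ + x₂) + 2a₆ - a₃(y₁ + y₂) - 2y₁y₂ - a₁(y₁x₂ + y₂x₁)`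
(expand `x₃ = λ² + a₁λ - a₂ - x₁ - x₂` and use both Weierstrass equations). Silverman, *AEC*,
III.2.3 (group law algorithm). [folklore] -/
theorem addX_sub_mul_sq {F : Type*} [Field F] [DecidableEq F] {W : WeierstrassCurve.Affine F}
    {x₁ x₂ y₁ y₂ : F} (h₁ : W.Equation x₁ y₁) (h₂ : W.Equation x₂ y₂) (hx : x₁ ≠ x₂) :
    (W.addX x₁ x₂ (W.slope x₁ x₂ y₁ y₂) - x₁) * (x₁ - x₂) ^ 2 =
      -x₁ ^ 3 + 3 * x₁ ^ 2 * x₂ + 2 * W.a₂ * x₁ * x₂ + W.a₄ * (x₁ + x₂) + 2 * W.a₆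
        - W.a₃ * (y₁ + y₂) - 2 * y₁ * y₂ - W.a₁ * (y₁ * x₂ + y₂ * x₁) := by
  rw [Affine.Equation, Affine.evalEval_polynomial, sub_eq_zero] at h₁ h₂
  have hx' : x₁ - x₂ ≠ 0 := sub_ne_zero.mpr hx
  have key : (W.addX x₁ x₂ (W.slope x₁ x₂ y₁ y₂) - x₁) * (x₁ - x₂) ^ 2 =
      (y₁ - y₂) ^ 2 + W.a₁ * (y₁ - y₂) * (x₁ - x₂) - (W.a₂ + 2 * x₁ + x₂) * (x₁ - x₂) ^ 2 := by
    rw [Affine.slope_of_X_ne hx, Affine.addX]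
    field_simp
    ring
  rw [key]
  linear_combination h₁ + h₂

section ValuedCurve

/-! ## A Weierstrass curve with integral coefficients over a discretely valued field -/

variable {L : Type*} [Field L] {v : Valuation L ℤᵐ⁰} {W : WeierstrassCurve.Affine L}

/-- The coefficients `a₁, a₂, a₃, a₄, a₆` of `W` are integral for `v` (`v aᵢ ≤ 1`). This is a
*predicate* on a valued Weierstrass curve `(v, W)` — the standing hypothesis
`(ha : IntegralCoeff v W)` of the valuation lemmas of this section, verified at every place of
`L = k(V)` for a base-changed curve by `integralCoeff_placeValuation` — and not a closed statement:
it fails e.g. for `a₁ = X` over `F(X)` with the valuation at infinity. [folklore] -/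
def IntegralCoeff (v : Valuation L ℤᵐ⁰) (W : WeierstrassCurve.Affine L) : Prop :=
  v W.a₁ ≤ 1 ∧ v W.a₂ ≤ 1 ∧ v W.a₃ ≤ 1 ∧ v W.a₄ ≤ 1 ∧ v W.a₆ ≤ 1

omit [Field L] in
/-- Naturals are integral for every valuation. [folklore] -/
theorem Valuation.natCast_le_one {R : Type*} [CommRing R] (v : Valuation R ℤᵐ⁰) (n : ℕ) :
    v (n : R) ≤ 1 := by
  induction n with
  | zero => simp
  | succ n ih =>
    rw [Nat.cast_succ]
    exact (Valuation.map_add _ _ _).trans (max_le ih (by rw [Valuation.map_one]))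

/-- Valuation bookkeeping for the chord identity: with `(u₁, w₁)` integral and `u₂` of valuation
`exp 2e`, the part of the right-hand side of `addX_sub_mul_sq` not involving `w₂` has valuation
`≤ exp 2e`. [folklore] -/
theorem chord_rhs_le (ha : IntegralCoeff v W) {u₁ w₁ u₂ : L} {e : ℕ}
    (hu₁ : v u₁ ≤ 1) (hw₁ : v w₁ ≤ 1) (hu₂ : v u₂ = WithZero.exp (2 * e : ℤ)) :
    v (-u₁ ^ 3 + 3 * u₁ ^ 2 * u₂ + 2 * W.a₂ * u₁ * u₂ + W.a₄ * (u₁ + u₂) + 2 * W.a₆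
        - W.a₃ * w₁ - W.a₁ * (w₁ * u₂)) ≤ WithZero.exp (2 * e : ℤ) := by
  obtain ⟨ha₁, ha₂, ha₃, ha₄, ha₆⟩ := ha
  have h2e : (1 : ℤᵐ⁰) ≤ WithZero.exp (2 * e : ℤ) := by
    rw [← WithZero.exp_zero, WithZero.exp_le_exp]; positivity
  have hc := Valuation.natCast_le_one v
  have t1 : v (-u₁ ^ 3) ≤ WithZero.exp (2 * e : ℤ) := by
    rw [Valuation.map_neg, map_pow]
    exact (pow_le_one₀ zero_le hu₁).trans h2e
  have t2 : v (3 * u₁ ^ 2 * u₂) ≤ WithZero.exp (2 * e : ℤ) := by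
    rw [map_mul, map_mul, map_pow, hu₂]
    calc v 3 * v u₁ ^ 2 * WithZero.exp (2 * e : ℤ) ≤ 1 * 1 * WithZero.exp (2 * e : ℤ) := by
          gcongr
          · exact_mod_cast hc 3
          · exact pow_le_one₀ zero_le hu₁
      _ = _ := by rw [one_mul, one_mul]
  have t3 : v (2 * W.a₂ * u₁ * u₂) ≤ WithZero.exp (2 * e : ℤ) := by
    rw [map_mul, map_mul, map_mul, hu₂]
    calc v 2 * v _ * v u₁ * WithZero.exp (2 * e : ℤ) ≤ 1 * 1 * 1 * WithZero.exp (2 * e : ℤ) := by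
          gcongr
          exact_mod_cast hc 2
      _ = _ := by rw [one_mul, one_mul, one_mul]
  have t4 : v (W.a₄ * (u₁ + u₂)) ≤ WithZero.exp (2 * e : ℤ) := by
    rw [map_mul]
    calc v _ * v (u₁ + u₂) ≤ 1 * WithZero.exp (2 * e : ℤ) := by
          gcongr
          exact (Valuation.map_add _ _ _).trans (max_le (hu₁.trans h2e) hu₂.le)
      _ = _ := one_mul _
  have t5 : v (2 * W.a₆) ≤ WithZero.exp (2 * e : ℤ) := by
    rw [map_mul]
    exact (mul_le_one' (by exact_mod_cast hc 2) ha₆).trans h2e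
  have t6 : v (W.a₃ * w₁) ≤ WithZero.exp (2 * e : ℤ) := by
    rw [map_mul]
    exact (mul_le_one' ha₃ hw₁).trans h2e
  have t7 : v (W.a₁ * (w₁ * u₂)) ≤ WithZero.exp (2 * e : ℤ) := by
    rw [map_mul, map_mul, hu₂]
    calc v _ * (v w₁ * WithZero.exp (2 * e : ℤ)) ≤ 1 * (1 * WithZero.exp (2 * e : ℤ)) := by gcongr
      _ = _ := by rw [one_mul, one_mul]
  refine (Valuation.map_sub _ _ _).trans (max_le ?_ t7)
  refine (Valuation.map_sub _ _ _).trans (max_le ?_ t6)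
  refine (Valuation.map_add _ _ _).trans (max_le ?_ t5)
  refine (Valuation.map_add _ _ _).trans (max_le ?_ t4)
  refine (Valuation.map_add _ _ _).trans (max_le ?_ t3)
  exact (Valuation.map_add _ _ _).trans (max_le t1 t2)

/-- **The chord through an integral point and a pole, `x`-coordinate**: for points
`B = (u₁, w₁)` integral for `v` and `A = (u₂, w₂)` with `v(u₂) = exp 2e`, `v(w₂) = exp 3e`
(`e ≥ 1`) of a curve with integral coefficients, the `x`-coordinate `x₃` of `A + B` satisfies
`v(x₃ - u₁) ≤ exp (-e)`: the sum reduces to a point with the `x`-coordinate of the reduction of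
`B`. Silverman, *AEC*, VII.§2 (Prop. VII.2.1: reduction is a homomorphism). [folklore] -/
theorem addX_sub_le [DecidableEq L] (ha : IntegralCoeff v W) {u₁ w₁ u₂ w₂ : L} {e : ℕ}
    (h₁ : W.Equation u₁ w₁) (h₂ : W.Equation u₂ w₂) (hu₁ : v u₁ ≤ 1) (hw₁ : v w₁ ≤ 1)
    (hu₂ : v u₂ = WithZero.exp (2 * e : ℤ)) (hw₂ : v w₂ = WithZero.exp (3 * e : ℤ)) (he : 0 < e) :
    v (W.addX u₁ u₂ (W.slope u₁ u₂ w₁ w₂) - u₁) ≤ WithZero.exp (-(e : ℤ)) := by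
  obtain ⟨ha₁, ha₂, ha₃, ha₄, ha₆⟩ := ha
  have hu12 : u₁ ≠ u₂ := by
    intro h; rw [h, hu₂, ← WithZero.exp_zero, WithZero.exp_le_exp] at hu₁; omega
  have key := addX_sub_mul_sq h₁ h₂ hu12
  have hsub : v (u₁ - u₂) = WithZero.exp (2 * e : ℤ) := by
    rw [sub_eq_add_neg, Valuation.map_add_eq_of_lt_right _ (by
      rw [Valuation.map_neg, hu₂]
      exact lt_of_le_of_lt hu₁ (by rw [← WithZero.exp_zero, WithZero.exp_lt_exp]; positivity)),
      Valuation.map_neg, hu₂]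
  have hT : v (-(w₂ * (2 * w₁ + W.a₁ * u₁ + W.a₃))) ≤ WithZero.exp (3 * e : ℤ) := by
    rw [Valuation.map_neg, map_mul, hw₂]
    calc WithZero.exp (3 * e : ℤ) * v _ ≤ WithZero.exp (3 * e : ℤ) * 1 := by
          gcongr
          refine (Valuation.map_add _ _ _).trans (max_le ((Valuation.map_add _ _ _).trans
            (max_le ?_ ?_)) ha₃)
          · rw [map_mul]
            exact mul_le_one' (by exact_mod_cast Valuation.natCast_le_one v 2) hw₁
          · rw [map_mul]; exact mul_le_one' ha₁ hu₁
      _ = _ := mul_one _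
  have hE := chord_rhs_le ⟨ha₁, ha₂, ha₃, ha₄, ha₆⟩ hu₁ hw₁ hu₂
  have hsplit : -u₁ ^ 3 + 3 * u₁ ^ 2 * u₂ + 2 * W.a₂ * u₁ * u₂ + W.a₄ * (u₁ + u₂) + 2 * W.a₆
      - W.a₃ * (w₁ + w₂) - 2 * w₁ * w₂ - W.a₁ * (w₁ * u₂ + w₂ * u₁) =
      -(w₂ * (2 * w₁ + W.a₁ * u₁ + W.a₃)) +
      (-u₁ ^ 3 + 3 * u₁ ^ 2 * u₂ + 2 * W.a₂ * u₁ * u₂ + W.a₄ * (u₁ + u₂) + 2 * W.a₆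
        - W.a₃ * w₁ - W.a₁ * (w₁ * u₂)) := by ring
  have hrhs : v ((W.addX u₁ u₂ (W.slope u₁ u₂ w₁ w₂) - u₁) * (u₁ - u₂) ^ 2) ≤
      WithZero.exp (3 * e : ℤ) := by
    rw [key, hsplit]
    refine (Valuation.map_add _ _ _).trans (max_le hT (hE.trans ?_))
    rw [WithZero.exp_le_exp]; omega
  rw [map_mul, map_pow, hsub, ← WithZero.exp_nsmul] at hrhs
  have h4 : WithZero.exp (2 • (2 * e : ℤ)) * WithZero.exp (-(2 • (2 * e : ℤ))) = 1 := by
    rw [← WithZero.exp_add, add_neg_cancel, WithZero.exp_zero]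
  calc v _ = v (W.addX u₁ u₂ (W.slope u₁ u₂ w₁ w₂) - u₁) * WithZero.exp (2 • (2 * e : ℤ)) *
        WithZero.exp (-(2 • (2 * e : ℤ))) := by rw [mul_assoc, h4, mul_one]
    _ ≤ WithZero.exp (3 * e : ℤ) * WithZero.exp (-(2 • (2 * e : ℤ))) := mul_le_mul_left hrhs _
    _ = WithZero.exp (-(e : ℤ)) := by
        rw [← WithZero.exp_add]; congr 1; rw [nsmul_eq_mul]; push_cast; ring

/-- **The chord through an integral point and a pole, exact order** (`LOC`): if moreover the
reduction of `B` is not `2`-torsion, i.e. `2w₁ + a₁u₁ + a₃` is a `v`-unit, then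
`v(x₃ - u₁) = exp (-e)` exactly (the dominant term of the chord identity is
`-w₂(2w₁ + a₁u₁ + a₃)`, of valuation `exp 3e`): the order of contact of `A + B` and `B` at the
place is the ramification `e` of `A`. [folklore] -/
theorem addX_sub_eq [DecidableEq L] (ha : IntegralCoeff v W) {u₁ w₁ u₂ w₂ : L} {e : ℕ}
    (h₁ : W.Equation u₁ w₁) (h₂ : W.Equation u₂ w₂) (hu₁ : v u₁ ≤ 1) (hw₁ : v w₁ ≤ 1)
    (hu₂ : v u₂ = WithZero.exp (2 * e : ℤ)) (hw₂ : v w₂ = WithZero.exp (3 * e : ℤ)) (he : 0 < e)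
    (hunit : v (2 * w₁ + W.a₁ * u₁ + W.a₃) = 1) :
    v (W.addX u₁ u₂ (W.slope u₁ u₂ w₁ w₂) - u₁) = WithZero.exp (-(e : ℤ)) := by
  obtain ⟨ha₁, ha₂, ha₃, ha₄, ha₆⟩ := ha
  have hu12 : u₁ ≠ u₂ := by
    intro h; rw [h, hu₂, ← WithZero.exp_zero, WithZero.exp_le_exp] at hu₁; omega
  have key := addX_sub_mul_sq h₁ h₂ hu12
  have hsub : v (u₁ - u₂) = WithZero.exp (2 * e : ℤ) := by
    rw [sub_eq_add_neg, Valuation.map_add_eq_of_lt_right _ (by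
      rw [Valuation.map_neg, hu₂]
      exact lt_of_le_of_lt hu₁ (by rw [← WithZero.exp_zero, WithZero.exp_lt_exp]; positivity)),
      Valuation.map_neg, hu₂]
  have hT : v (-(w₂ * (2 * w₁ + W.a₁ * u₁ + W.a₃))) = WithZero.exp (3 * e : ℤ) := by
    rw [Valuation.map_neg, map_mul, hw₂, hunit, mul_one]
  have hE := chord_rhs_le ⟨ha₁, ha₂, ha₃, ha₄, ha₆⟩ hu₁ hw₁ hu₂
  have hsplit : -u₁ ^ 3 + 3 * u₁ ^ 2 * u₂ + 2 * W.a₂ * u₁ * u₂ + W.a₄ * (u₁ + u₂) + 2 * W.a₆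
      - W.a₃ * (w₁ + w₂) - 2 * w₁ * w₂ - W.a₁ * (w₁ * u₂ + w₂ * u₁) =
      -(w₂ * (2 * w₁ + W.a₁ * u₁ + W.a₃)) +
      (-u₁ ^ 3 + 3 * u₁ ^ 2 * u₂ + 2 * W.a₂ * u₁ * u₂ + W.a₄ * (u₁ + u₂) + 2 * W.a₆
        - W.a₃ * w₁ - W.a₁ * (w₁ * u₂)) := by ring
  have hrhs : v ((W.addX u₁ u₂ (W.slope u₁ u₂ w₁ w₂) - u₁) * (u₁ - u₂) ^ 2) =
      WithZero.exp (3 * e : ℤ) := by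
    rw [key, hsplit, Valuation.map_add_eq_of_lt_left _ (by
      rw [hT]; exact lt_of_le_of_lt hE (by rw [WithZero.exp_lt_exp]; omega)), hT]
  rw [map_mul, map_pow, hsub, ← WithZero.exp_nsmul] at hrhs
  have h4 : WithZero.exp (2 • (2 * e : ℤ)) * WithZero.exp (-(2 • (2 * e : ℤ))) = 1 := by
    rw [← WithZero.exp_add, add_neg_cancel, WithZero.exp_zero]
  calc v _ = v (W.addX u₁ u₂ (W.slope u₁ u₂ w₁ w₂) - u₁) * WithZero.exp (2 • (2 * e : ℤ)) *
        WithZero.exp (-(2 • (2 * e : ℤ))) := by rw [mul_assoc, h4, mul_one]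
    _ = WithZero.exp (3 * e : ℤ) * WithZero.exp (-(2 • (2 * e : ℤ))) := by rw [hrhs]
    _ = WithZero.exp (-(e : ℤ)) := by
        rw [← WithZero.exp_add]; congr 1; rw [nsmul_eq_mul]; push_cast; ring

/-! ## The chord through two integral points -/

/-- **Difference of Weierstrass equations**:
`(y₁ - y₂)(y₁ + y₂ + a₁x₂ + a₃) = (x₁ - x₂)(x₁² + x₁x₂ + x₂² + a₂(x₁ + x₂) + a₄ - a₁y₁)`.
[folklore] -/
theorem sub_mul_eq_sub_mul {F : Type*} [Field F] {W : WeierstrassCurve.Affine F} {x₁ x₂ y₁ y₂ : F}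
    (h₁ : W.Equation x₁ y₁) (h₂ : W.Equation x₂ y₂) :
    (y₁ - y₂) * (y₁ + y₂ + W.a₁ * x₂ + W.a₃) =
      (x₁ - x₂) * (x₁ ^ 2 + x₁ * x₂ + x₂ ^ 2 + W.a₂ * (x₁ + x₂) + W.a₄ - W.a₁ * y₁) := by
  rw [Affine.Equation, Affine.evalEval_polynomial, sub_eq_zero] at h₁ h₂
  linear_combination h₁ - h₂

/-- `addX`, `addY` of integral arguments are integral. [folklore] -/
theorem addX_le_one (ha : IntegralCoeff v W) {x₁ x₂ ℓ : L} (hx₁ : v x₁ ≤ 1) (hx₂ : v x₂ ≤ 1)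
    (hℓ : v ℓ ≤ 1) : v (W.addX x₁ x₂ ℓ) ≤ 1 := by
  obtain ⟨ha₁, ha₂, -, -, -⟩ := ha
  rw [Affine.addX]
  refine (Valuation.map_sub _ _ _).trans (max_le ((Valuation.map_sub _ _ _).trans (max_le
    ((Valuation.map_sub _ _ _).trans (max_le ((Valuation.map_add _ _ _).trans (max_le ?_ ?_)) ha₂))
    hx₁)) hx₂)
  · rw [map_pow]; exact pow_le_one₀ zero_le hℓ
  · rw [map_mul]; exact mul_le_one' ha₁ hℓ

/-- `addY` of integral arguments is integral. [folklore] -/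
theorem addY_le_one (ha : IntegralCoeff v W) {x₁ x₂ y₁ ℓ : L} (hx₁ : v x₁ ≤ 1) (hx₂ : v x₂ ≤ 1)
    (hy₁ : v y₁ ≤ 1) (hℓ : v ℓ ≤ 1) : v (W.addY x₁ x₂ y₁ ℓ) ≤ 1 := by
  have hX := addX_le_one ha hx₁ hx₂ hℓ
  obtain ⟨ha₁, -, ha₃, -, -⟩ := ha
  rw [Affine.addY, Affine.negY, Affine.negAddY]
  refine (Valuation.map_sub _ _ _).trans (max_le ((Valuation.map_sub _ _ _).trans (max_le ?_ ?_))
    ha₃)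
  · rw [Valuation.map_neg]
    refine (Valuation.map_add _ _ _).trans (max_le ?_ hy₁)
    rw [map_mul]
    exact mul_le_one' hℓ ((Valuation.map_sub _ _ _).trans (max_le hX hx₁))
  · rw [map_mul]; exact mul_le_one' ha₁ hX

/-- **Chord through integral points with distinct reduced `x`-coordinates**: if `x₁ - x₂` is a
unit then the slope is integral. [folklore] -/
theorem slope_le_one_of_sub_eq_one [DecidableEq L] {x₁ x₂ y₁ y₂ : L} (hy₁ : v y₁ ≤ 1)
    (hy₂ : v y₂ ≤ 1)
    (hx : v (x₁ - x₂) = 1) : v (W.slope x₁ x₂ y₁ y₂) ≤ 1 := by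
  have hx12 : x₁ ≠ x₂ := fun h ↦ by rw [h, sub_self, map_zero] at hx; exact zero_ne_one hx
  rw [Affine.slope_of_X_ne hx12, map_div₀, hx, div_one]
  exact (Valuation.map_sub _ _ _).trans (max_le hy₁ hy₂)

/-- If the slope `λ` has `v(λ) > 1` then `x₃ = λ² + a₁λ - a₂ - x₁ - x₂` has `v(x₃) = v(λ)² > 1`
(the sum reduces to `O`). [folklore] -/
theorem one_lt_addX_of_one_lt (ha : IntegralCoeff v W) {x₁ x₂ ℓ : L} (hx₁ : v x₁ ≤ 1)
    (hx₂ : v x₂ ≤ 1) (hℓ : 1 < v ℓ) : v (W.addX x₁ x₂ ℓ) = v ℓ ^ 2 ∧ 1 < v (W.addX x₁ x₂ ℓ) := by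
  obtain ⟨ha₁, ha₂, -, -, -⟩ := ha
  have hℓ0 : 0 < v ℓ := lt_trans zero_lt_one hℓ
  have hsq : v ℓ < v ℓ ^ 2 := by rw [sq]; exact lt_mul_of_one_lt_left hℓ0 hℓ
  have h1 : 1 < v ℓ ^ 2 := lt_trans hℓ hsq
  have key : v (W.addX x₁ x₂ ℓ) = v ℓ ^ 2 := by
    rw [Affine.addX]
    have e1 : v (ℓ ^ 2 + W.a₁ * ℓ) = v (ℓ ^ 2) := Valuation.map_add_eq_of_lt_left _ (by
      rw [map_mul, map_pow]
      exact lt_of_le_of_lt (mul_le_of_le_one_left zero_le ha₁) hsq)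
    have e2 : v (ℓ ^ 2 + W.a₁ * ℓ - W.a₂) = v (ℓ ^ 2) := by
      rw [sub_eq_add_neg, Valuation.map_add_eq_of_lt_left _ (by
        rw [e1, Valuation.map_neg, map_pow]; exact lt_of_le_of_lt ha₂ h1), e1]
    have e3 : v (ℓ ^ 2 + W.a₁ * ℓ - W.a₂ - x₁) = v (ℓ ^ 2) := by
      rw [sub_eq_add_neg, Valuation.map_add_eq_of_lt_left _ (by
        rw [e2, Valuation.map_neg, map_pow]; exact lt_of_le_of_lt hx₁ h1), e2]
    rw [sub_eq_add_neg, Valuation.map_add_eq_of_lt_left _ (by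
      rw [e3, Valuation.map_neg, map_pow]; exact lt_of_le_of_lt hx₂ h1), e3, map_pow]
  exact ⟨key, key ▸ h1⟩

/-- **Chord through integral points with the same reduced `x` but different reduced `y`**
(reductions `R` and `-R ≠ R`): `v(x₁ - x₂) < 1`, `v(y₁ - y₂) = 1` force the slope to have
`v > 1`, so the sum reduces to `O` — provided `x₁ ≠ x₂` (if `x₁ = x₂` the sum is `O` anyway).
[folklore] -/
theorem one_lt_slope_of_opposite [DecidableEq L] {x₁ x₂ y₁ y₂ : L} (hx12 : x₁ ≠ x₂)
    (hx : v (x₁ - x₂) < 1)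
    (hy : v (y₁ - y₂) = 1) : 1 < v (W.slope x₁ x₂ y₁ y₂) := by
  have hx0 : v (x₁ - x₂) ≠ 0 := (Valuation.ne_zero_iff _).mpr (sub_ne_zero.mpr hx12)
  rw [Affine.slope_of_X_ne hx12, map_div₀, hy, one_div, one_lt_inv₀ ((Valuation.pos_iff _).mpr
    (sub_ne_zero.mpr hx12))]
  exact hx

/-- **Chord through integral points with the same reduction `R ∉ W[2]`** (the tangent case at
the level of reductions): if `v(x₁ - x₂) < 1` but `y₁ + y₂ + a₁x₂ + a₃` is a unit, the slope is
integral (by the difference of the Weierstrass equations it equals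
`(x₁² + x₁x₂ + x₂² + a₂(x₁ + x₂) + a₄ - a₁y₁)/(y₁ + y₂ + a₁x₂ + a₃)`), so the sum reduces to an
affine point. If `x₁ = x₂` then `y₁ = y₂` and this is the tangent slope. [folklore] -/
theorem slope_le_one_of_tangent [DecidableEq L] (ha : IntegralCoeff v W) {x₁ x₂ y₁ y₂ : L}
    (h₁ : W.Equation x₁ y₁)
    (h₂ : W.Equation x₂ y₂) (hx₁ : v x₁ ≤ 1) (hx₂ : v x₂ ≤ 1) (hy₁ : v y₁ ≤ 1)
    (hx : v (x₁ - x₂) < 1) (hunit : v (y₁ + y₂ + W.a₁ * x₂ + W.a₃) = 1) :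
    v (W.slope x₁ x₂ y₁ y₂) ≤ 1 := by
  obtain ⟨ha₁, ha₂, ha₃, ha₄, -⟩ := ha
  have hD0 : y₁ + y₂ + W.a₁ * x₂ + W.a₃ ≠ 0 := fun h ↦ by
    rw [h, map_zero] at hunit; exact zero_ne_one hunit
  have hN : v (x₁ ^ 2 + x₁ * x₂ + x₂ ^ 2 + W.a₂ * (x₁ + x₂) + W.a₄ - W.a₁ * y₁) ≤ 1 := by
    refine (Valuation.map_sub _ _ _).trans (max_le ((Valuation.map_add _ _ _).trans (max_le
      ((Valuation.map_add _ _ _).trans (max_le ((Valuation.map_add _ _ _).trans (max_le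
      ((Valuation.map_add _ _ _).trans (max_le ?_ ?_)) ?_)) ?_)) ha₄)) ?_)
    · rw [map_pow]; exact pow_le_one₀ zero_le hx₁
    · rw [map_mul]; exact mul_le_one' hx₁ hx₂
    · rw [map_pow]; exact pow_le_one₀ zero_le hx₂
    · rw [map_mul]; exact mul_le_one' ha₂ ((Valuation.map_add _ _ _).trans (max_le hx₁ hx₂))
    · rw [map_mul]; exact mul_le_one' ha₁ hy₁
  by_cases hx12 : x₁ = x₂
  · -- `y₂ = y₁` (the other root would kill the unit), tangent slope
    subst hx12
    rcases Affine.Y_eq_of_X_eq h₁ h₂ rfl with hy | hy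
    · subst hy
      have hne : y₁ ≠ W.negY x₁ y₁ := by
        intro h
        apply hD0
        rw [Affine.negY] at h
        linear_combination h
      rw [Affine.slope_of_Y_ne rfl hne, map_div₀]
      have hden : v (y₁ - W.negY x₁ y₁) = 1 := by
        rw [← hunit, Affine.negY]; congr 1; ring
      rw [hden, div_one]
      refine (Valuation.map_sub _ _ _).trans (max_le ((Valuation.map_add _ _ _).trans (max_le
        ((Valuation.map_add _ _ _).trans (max_le ?_ ?_)) ha₄)) ?_)
      · rw [map_mul, map_pow]
        exact mul_le_one' (by exact_mod_cast Valuation.natCast_le_one v 3) (pow_le_one₀ zero_le hx₁)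
      · rw [map_mul, map_mul]
        exact mul_le_one' (mul_le_one' (by exact_mod_cast Valuation.natCast_le_one v 2) ha₂) hx₁
      · rw [map_mul]; exact mul_le_one' ha₁ hy₁
    · exfalso
      apply hD0
      rw [hy, Affine.negY]; ring
  · have key := sub_mul_eq_sub_mul h₁ h₂
    have hslope : W.slope x₁ x₂ y₁ y₂ =
        (x₁ ^ 2 + x₁ * x₂ + x₂ ^ 2 + W.a₂ * (x₁ + x₂) + W.a₄ - W.a₁ * y₁) /
          (y₁ + y₂ + W.a₁ * x₂ + W.a₃) := by
      rw [Affine.slope_of_X_ne hx12, div_eq_div_iff (sub_ne_zero.mpr hx12) hD0]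
      linear_combination key
    rw [hslope, map_div₀, hunit, div_one]
    exact hN

/-- The numerator `x₁² + x₁x₂ + x₂² + a₂(x₁ + x₂) + a₄ - a₁y₁` of the tangent-type slope is
integral. [folklore] -/
theorem tangentNum_le_one (ha : IntegralCoeff v W) {x₁ x₂ y₁ : L} (hx₁ : v x₁ ≤ 1)
    (hx₂ : v x₂ ≤ 1) (hy₁ : v y₁ ≤ 1) :
    v (x₁ ^ 2 + x₁ * x₂ + x₂ ^ 2 + W.a₂ * (x₁ + x₂) + W.a₄ - W.a₁ * y₁) ≤ 1 := by
  obtain ⟨ha₁, ha₂, -, ha₄, -⟩ := ha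
  refine (Valuation.map_sub _ _ _).trans (max_le ((Valuation.map_add _ _ _).trans (max_le
    ((Valuation.map_add _ _ _).trans (max_le ((Valuation.map_add _ _ _).trans (max_le
    ((Valuation.map_add _ _ _).trans (max_le ?_ ?_)) ?_)) ?_)) ha₄)) ?_)
  · rw [map_pow]; exact pow_le_one₀ zero_le hx₁
  · rw [map_mul]; exact mul_le_one' hx₁ hx₂
  · rw [map_pow]; exact pow_le_one₀ zero_le hx₂
  · rw [map_mul]; exact mul_le_one' ha₂ ((Valuation.map_add _ _ _).trans (max_le hx₁ hx₂))
  · rw [map_mul]; exact mul_le_one' ha₁ hy₁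

/-- **The dichotomy at a common reduced `x`-coordinate**: for integral points `(x₁, y₁)`,
`(x₂, y₂)` with `v(x₁ - x₂) < 1` whose common reduction is not `2`-torsion
(`2y₂ + a₁x₂ + a₃` a unit), either `y₁ - y₂` is a unit (opposite reductions) or
`y₁ + y₂ + a₁x₂ + a₃` is a unit (equal reductions): their product is `(x₁ - x₂) · (integral)`
and they differ from `∓(2y₂ + a₁x₂ + a₃)` by each other. [folklore] -/
theorem unit_dichotomy (ha : IntegralCoeff v W) {x₁ x₂ y₁ y₂ : L} (h₁ : W.Equation x₁ y₁)
    (h₂ : W.Equation x₂ y₂) (hx₁ : v x₁ ≤ 1) (hx₂ : v x₂ ≤ 1) (hy₁ : v y₁ ≤ 1) (hy₂ : v y₂ ≤ 1)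
    (hx : v (x₁ - x₂) < 1) (hunit : v (2 * y₂ + W.a₁ * x₂ + W.a₃) = 1) :
    v (y₁ - y₂) = 1 ∨ v (y₁ + y₂ + W.a₁ * x₂ + W.a₃) = 1 := by
  have hN := tangentNum_le_one ha hx₁ hx₂ hy₁
  obtain ⟨ha₁, -, ha₃, -, -⟩ := ha
  have hs₁ : v (y₁ - y₂) ≤ 1 := Valuation.map_sub_le _ hy₁ hy₂
  have hs₂ : v (y₁ + y₂ + W.a₁ * x₂ + W.a₃) ≤ 1 :=
    (Valuation.map_add _ _ _).trans (max_le ((Valuation.map_add _ _ _).trans (max_le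
      ((Valuation.map_add _ _ _).trans (max_le hy₁ hy₂))
      (by rw [map_mul]; exact mul_le_one' ha₁ hx₂)))
      ha₃)
  have hprod : v ((y₁ - y₂) * (y₁ + y₂ + W.a₁ * x₂ + W.a₃)) < 1 := by
    rw [sub_mul_eq_sub_mul h₁ h₂, map_mul]
    exact (mul_le_mul' le_rfl hN).trans_lt (by rwa [mul_one])
  have hor : v (y₁ - y₂) < 1 ∨ v (y₁ + y₂ + W.a₁ * x₂ + W.a₃) < 1 := by
    by_contra hcon
    push Not at hcon
    have := mul_le_mul' hcon.1 hcon.2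
    rw [one_mul, ← map_mul] at this
    exact not_lt_of_ge this hprod
  rcases hor with hlt | hlt
  · right
    have : y₁ + y₂ + W.a₁ * x₂ + W.a₃ = (2 * y₂ + W.a₁ * x₂ + W.a₃) + (y₁ - y₂) := by ring
    rw [this, Valuation.map_add_eq_of_lt_left _ (by rwa [hunit]), hunit]
  · left
    have : y₁ - y₂ = (y₁ + y₂ + W.a₁ * x₂ + W.a₃) - (2 * y₂ + W.a₁ * x₂ + W.a₃) := by ring
    rw [this, Valuation.map_sub_eq_of_lt_right _ (by rwa [hunit]), hunit]

end ValuedCurve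

section Places

/-! ## `L`-points of `V'` at a place of `L = k(V)` -/

variable {V : WeierstrassCurve.Affine k} [V.IsElliptic] {V' : WeierstrassCurve.Affine k}
  [V'.IsElliptic]

omit [V'.IsElliptic] in
/-- The coefficients of `V'/L` are integral at every place of `L`. [folklore] -/
theorem integralCoeff_placeValuation (P : V.Point) :
    IntegralCoeff (placeValuation V P) (V'.baseChange V.FunctionField).toAffine :=
  placeValuation_baseChange_a_le_one P

/-- A function with a pole at some place is transcendental over `k`. [folklore] -/
theorem transcendental_of_one_lt {P : V.Point} {u : V.FunctionField}
    (hu : 1 < placeValuation V P u) : Transcendental k u :=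
  Valuation.transcendental_of_ne_one k u
    (fun h ↦ by rw [h, map_zero] at hu; exact not_lt_zero hu) hu.ne'

/-- `v_P(u) = exp n` gives `ord_P(u) = -n`. [folklore] -/
theorem ord_eq_of_placeValuation_eq {P : V.Point} {u : V.FunctionField} {n : ℤ}
    (h : placeValuation V P u = WithZero.exp n) : ord V P u = -n := by
  rw [ord, h, WithZero.log_exp]

/-- An integral function has residue `0` iff it lies in the maximal ideal. [folklore] -/
theorem placeRes_eq_zero_iff (P : V.Point) {u : V.FunctionField}
    (hu : placeValuation V P u ≤ 1) : placeRes V P u = 0 ↔ placeValuation V P u < 1 := by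
  constructor
  · intro h0
    have := placeValuation_sub_placeRes_lt_one P hu
    rwa [h0, map_zero, sub_zero] at this
  · intro hlt
    exact placeRes_eq_of_lt_one P (by rwa [map_zero, sub_zero])

/-- An integral function is a unit iff its residue is non-zero. [folklore] -/
theorem placeValuation_eq_one_iff (P : V.Point) {u : V.FunctionField}
    (hu : placeValuation V P u ≤ 1) : placeValuation V P u = 1 ↔ placeRes V P u ≠ 0 := by
  rw [Ne, placeRes_eq_zero_iff P hu, not_lt]
  exact ⟨fun h ↦ h.ge, fun h ↦ le_antisymm hu h⟩

omit [V'.IsElliptic] in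
/-- `-y - a₁x - a₃` is integral for integral `x, y`. [folklore] -/
theorem placeValuation_negY_le_one (P : V.Point) {u w : V.FunctionField}
    (hu : placeValuation V P u ≤ 1) (hw : placeValuation V P w ≤ 1) :
    placeValuation V P ((V'.baseChange V.FunctionField).toAffine.negY u w) ≤ 1 := by
  obtain ⟨ha₁, -, ha₃, -, -⟩ := placeValuation_baseChange_a_le_one (V' := V') P
  rw [Affine.negY]
  refine (Valuation.map_sub _ _ _).trans (max_le ((Valuation.map_sub _ _ _).trans (max_le ?_ ?_))
    ha₃)
  · rwa [Valuation.map_neg]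
  · rw [map_mul]; exact mul_le_one' ha₁ hu

/-- **On the fibre over `O'`**: if `A(P) = O'` for the non-constant `L`-point `A = (u, w)` then
`v_P(u) = exp 2e_A(P)` and `v_P(w) = exp 3e_A(P)` (pull back `x'`, `y'`, of orders `-2`, `-3`
at `O'`). Silverman, *AEC*, II.§2. [folklore] -/
theorem placeValuation_eq_exp_ramificationIdx (P : V.Point) {u w : V.FunctionField}
    (h : (V'.baseChange V.FunctionField).toAffine.Nonsingular u w) (hu : Transcendental k u)
    (h0 : specialize V V' P (.some u w h) = 0) :
    placeValuation V P u = WithZero.exp (2 * ramificationIdx V V' P h hu : ℤ) ∧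
      placeValuation V P w = WithZero.exp (3 * ramificationIdx V V' P h hu : ℤ) := by
  have hu1 : 1 < placeValuation V P u := (specialize_some_eq_zero_iff P h).mp h0
  have hu0 : u ≠ 0 := fun h' ↦ by rw [h', map_zero] at hu1; exact not_lt_zero hu1
  have hX0 : xF V' ≠ 0 := by
    intro hX
    have := ord_zero_X (V := V')
    change ord V' 0 (xF V') = -2 at this
    rw [hX] at this
    simp [ord] at this
  have hvX : placeValuation V' 0 (xF V') = WithZero.exp 2 := by
    rw [placeValuation_eq_exp_neg_ord 0 hX0]
    change WithZero.exp (-ord V' 0 (algebraMap k[X] V'.FunctionField X)) = _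
    rw [ord_zero_X]; norm_num
  have hx := placeValuation_pointPullback P h hu (xF V')
  rw [pointPullback_xF, h0, hvX, ← WithZero.exp_nsmul] at hx
  have hx' : placeValuation V P u = WithZero.exp (2 * ramificationIdx V V' P h hu : ℤ) := by
    rw [hx]; congr 1; rw [nsmul_eq_mul]; ring
  refine ⟨hx', ?_⟩
  obtain ⟨e', -, hu', hw'⟩ := exists_ord_eq_of_pole h.left hu1
  have hw0 : w ≠ 0 := by
    rintro rfl
    have := (placeValuation_pole h.left hu1).2
    rw [map_zero] at this; exact not_lt_zero this
  rw [placeValuation_eq_exp_neg_ord P hu0, WithZero.exp_inj] at hx'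
  rw [placeValuation_eq_exp_neg_ord P hw0, hw']
  congr 1
  omega

variable (V V') in
/-- **`ε_X(P)`**: the ramification index `e_X(P)` of the `L`-point `X` at the place `P` if
`X ≠ O` and `X(P) = O'` (then `x(X)` has a pole at `P`, so `X` is non-constant), and `0`
otherwise. Summing over `P` gives the degree of the fibre of `X` over `O'`. Silverman, *AEC*,
II.§2. [folklore] -/
def poleIdx (P : V.Point) : (V'.baseChange V.FunctionField).toAffine.Point → ℕ
  | .zero => 0
  | .some u _ h =>
    if hu : 1 < placeValuation V P u then ramificationIdx V V' P h (transcendental_of_one_lt hu)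
    else 0

/-- `ε_O(P) = 0`. [folklore] -/
theorem poleIdx_zero (P : V.Point) :
    poleIdx V V' P (0 : (V'.baseChange V.FunctionField).toAffine.Point) = 0 := rfl

/-- `ε_X(P) = 0` if `x(X)` is integral at `P`. [folklore] -/
theorem poleIdx_some_of_le_one (P : V.Point) {u w : V.FunctionField}
    (h : (V'.baseChange V.FunctionField).toAffine.Nonsingular u w)
    (hu : placeValuation V P u ≤ 1) : poleIdx V V' P (.some u w h) = 0 := by
  rw [poleIdx, dif_neg (not_lt.mpr hu)]

/-- `ε_X(P) = e_X(P)` if `x(X)` has a pole at `P`. [folklore] -/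
theorem poleIdx_some_of_one_lt (P : V.Point) {u w : V.FunctionField}
    (h : (V'.baseChange V.FunctionField).toAffine.Nonsingular u w)
    (hu1 : 1 < placeValuation V P u) (hu : Transcendental k u) :
    poleIdx V V' P (.some u w h) = ramificationIdx V V' P h hu := by
  rw [poleIdx, dif_pos hu1]

/-! ## The chord rules at a place -/

/-- **Pole plus integral point**: if `A(P) = O'` and `x(B)` is integral at `P` then
`v_P(x(B + A) - x(B)) ≤ exp (-e_A(P))`; in particular `B + A` is integral at `P` with the
`x`-residue of `B`. [folklore] -/
theorem placeValuation_addX_sub_le (P : V.Point) {uA wA uB wB : V.FunctionField}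
    (hA : (V'.baseChange V.FunctionField).toAffine.Nonsingular uA wA) (huA : Transcendental k uA)
    (hA0 : specialize V V' P (.some uA wA hA) = 0)
    (hB : (V'.baseChange V.FunctionField).toAffine.Equation uB wB)
    (hiB : placeValuation V P uB ≤ 1) :
    placeValuation V P ((V'.baseChange V.FunctionField).toAffine.addX uB uA
      ((V'.baseChange V.FunctionField).toAffine.slope uB uA wB wA) - uB) ≤
      WithZero.exp (-(ramificationIdx V V' P hA huA : ℤ)) := by
  obtain ⟨heu, hew⟩ := placeValuation_eq_exp_ramificationIdx P hA huA hA0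
  exact addX_sub_le (integralCoeff_placeValuation P) hB hA.left hiB
    (placeValuation_y_le_one hB hiB) heu hew (ramificationIdx_pos P hA huA)

/-- **Pole plus integral point, exact order**: if moreover `B(P) ∉ V'[2]`, i.e.
`2y(B) + a₁x(B) + a₃` is a unit at `P`, then `v_P(x(B + A) - x(B)) = exp (-e_A(P))`.
[folklore] -/
theorem placeValuation_addX_sub_eq (P : V.Point) {uA wA uB wB : V.FunctionField}
    (hA : (V'.baseChange V.FunctionField).toAffine.Nonsingular uA wA) (huA : Transcendental k uA)
    (hA0 : specialize V V' P (.some uA wA hA) = 0)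
    (hB : (V'.baseChange V.FunctionField).toAffine.Equation uB wB)
    (hiB : placeValuation V P uB ≤ 1)
    (hunit : placeValuation V P (2 * wB + (V'.baseChange V.FunctionField).toAffine.a₁ * uB +
      (V'.baseChange V.FunctionField).toAffine.a₃) = 1) :
    placeValuation V P ((V'.baseChange V.FunctionField).toAffine.addX uB uA
      ((V'.baseChange V.FunctionField).toAffine.slope uB uA wB wA) - uB) =
      WithZero.exp (-(ramificationIdx V V' P hA huA : ℤ)) := by
  obtain ⟨heu, hew⟩ := placeValuation_eq_exp_ramificationIdx P hA huA hA0
  exact addX_sub_eq (integralCoeff_placeValuation P) hB hA.left hiB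
    (placeValuation_y_le_one hB hiB) heu hew (ramificationIdx_pos P hA huA) hunit

/-- **Pole plus integral point is integral**, `ε_{B + A}(P) = 0`. [folklore] -/
theorem poleIdx_add_of_pole (P : V.Point) {uA wA uB wB : V.FunctionField}
    (hA : (V'.baseChange V.FunctionField).toAffine.Nonsingular uA wA)
    (hA0 : specialize V V' P (.some uA wA hA) = 0)
    (hB : (V'.baseChange V.FunctionField).toAffine.Nonsingular uB wB)
    (hiB : placeValuation V P uB ≤ 1) :
    poleIdx V V' P (.some uB wB hB + .some uA wA hA) = 0 := by
  have hu1 : 1 < placeValuation V P uA := (specialize_some_eq_zero_iff P hA).mp hA0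
  have huA := transcendental_of_one_lt hu1
  have hne : uB ≠ uA := fun h ↦ by rw [h] at hiB; exact not_lt_of_ge hiB hu1
  rw [Affine.Point.add_of_X_ne hne]
  refine poleIdx_some_of_le_one P _ ?_
  have hle := placeValuation_addX_sub_le P hA huA hA0 hB.left hiB
  have h1 : WithZero.exp (-(ramificationIdx V V' P hA huA : ℤ)) ≤ 1 := by
    rw [← WithZero.exp_zero, WithZero.exp_le_exp]; omega
  have := Valuation.map_add (placeValuation V P)
    ((V'.baseChange V.FunctionField).toAffine.addX uB uA
      ((V'.baseChange V.FunctionField).toAffine.slope uB uA wB wA) - uB) uB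
  rw [sub_add_cancel] at this
  exact this.trans (max_le (hle.trans h1) hiB)

/-! ## The four cases of the pointwise identity -/

/-- **Difference of `x`-coordinates at a pole of `A`**: if `A(P) = O'` and `x(B)` is integral at
`P` then `ord_P(x(A) - x(B)) = -2e_A(P)`. [folklore] -/
theorem ord_sub_of_pole (P : V.Point) {uA wA : V.FunctionField} (uB : V.FunctionField)
    (hA : (V'.baseChange V.FunctionField).toAffine.Nonsingular uA wA) (huA : Transcendental k uA)
    (hA0 : specialize V V' P (.some uA wA hA) = 0) (hiB : placeValuation V P uB ≤ 1) :
    ord V P (uA - uB) = -(2 * ramificationIdx V V' P hA huA : ℤ) := by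
  obtain ⟨heu, -⟩ := placeValuation_eq_exp_ramificationIdx P hA huA hA0
  refine ord_eq_of_placeValuation_eq ?_
  rw [Valuation.map_sub_eq_of_lt_left _ ?_, heu]
  rw [heu]
  refine hiB.trans_lt ?_
  rw [← WithZero.exp_zero, WithZero.exp_lt_exp]
  have := ramificationIdx_pos P hA huA
  omega

/-- **Integral points with distinct reduced `x`-coordinates add to an integral point**:
`ε_{A + B}(P) = 0`. [folklore] -/
theorem poleIdx_add_of_sub_eq_one (P : V.Point) {uA wA uB wB : V.FunctionField}
    (hA : (V'.baseChange V.FunctionField).toAffine.Nonsingular uA wA)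
    (hB : (V'.baseChange V.FunctionField).toAffine.Nonsingular uB wB)
    (hiA : placeValuation V P uA ≤ 1) (hiB : placeValuation V P uB ≤ 1)
    (hx : placeValuation V P (uA - uB) = 1) :
    poleIdx V V' P (.some uA wA hA + .some uB wB hB) = 0 := by
  have hne : uA ≠ uB := fun h ↦ by
    rw [h, sub_self, map_zero] at hx; exact zero_ne_one hx
  rw [Affine.Point.add_of_X_ne hne]
  exact poleIdx_some_of_le_one P _ (addX_le_one (integralCoeff_placeValuation P) hiA hiB
    (slope_le_one_of_sub_eq_one (placeValuation_y_le_one hA.left hiA)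
      (placeValuation_y_le_one hB.left hiB) hx))

/-- **Opposite-type pairs add to a pole**: integral `A`, `B` with `v_P(x(A) - x(B)) < 1` and
`y(A) - y(B)` a unit at `P` have `(A + B)(P) = O'`. [folklore] -/
theorem specialize_add_of_opposite (P : V.Point) {uA wA uB wB : V.FunctionField}
    (hA : (V'.baseChange V.FunctionField).toAffine.Nonsingular uA wA)
    (hB : (V'.baseChange V.FunctionField).toAffine.Nonsingular uB wB)
    (hiA : placeValuation V P uA ≤ 1) (hiB : placeValuation V P uB ≤ 1)
    (hx : placeValuation V P (uA - uB) < 1) (hy : placeValuation V P (wA - wB) = 1) :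
    specialize V V' P (.some uA wA hA + .some uB wB hB) = 0 := by
  by_cases hux : uA = uB
  · have hwy : wA ≠ wB := fun h ↦ by
      rw [h, sub_self, map_zero] at hy; exact zero_ne_one hy
    rcases Affine.Y_eq_of_X_eq hA.left hB.left hux with h | h
    · exact absurd h hwy
    · rw [Affine.Point.add_of_Y_eq hux h, specialize_zero]
  · rw [Affine.Point.add_of_X_ne hux]
    exact specialize_some_of_one_lt P _ (one_lt_addX_of_one_lt (integralCoeff_placeValuation P)
      hiA hiB (one_lt_slope_of_opposite hux hx hy)).2

/-- **Tangent-type pairs add to an integral point**: integral `A`, `B` with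
`v_P(x(A) - x(B)) < 1` and `y(A) + y(B) + a₁x(B) + a₃` a unit at `P` have `ε_{A + B}(P) = 0`.
[folklore] -/
theorem poleIdx_add_of_tangent (P : V.Point) {uA wA uB wB : V.FunctionField}
    (hA : (V'.baseChange V.FunctionField).toAffine.Nonsingular uA wA)
    (hB : (V'.baseChange V.FunctionField).toAffine.Nonsingular uB wB)
    (hiA : placeValuation V P uA ≤ 1) (hiB : placeValuation V P uB ≤ 1)
    (hx : placeValuation V P (uA - uB) < 1)
    (hunit : placeValuation V P (wA + wB + (V'.baseChange V.FunctionField).toAffine.a₁ * uB +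
      (V'.baseChange V.FunctionField).toAffine.a₃) = 1) :
    poleIdx V V' P (.some uA wA hA + .some uB wB hB) = 0 := by
  have hxy : ¬(uA = uB ∧ wA = (V'.baseChange V.FunctionField).toAffine.negY uB wB) := by
    rintro ⟨-, h⟩
    rw [h, Affine.negY] at hunit
    have : -wB - (V'.baseChange V.FunctionField).toAffine.a₁ * uB -
        (V'.baseChange V.FunctionField).toAffine.a₃ + wB +
        (V'.baseChange V.FunctionField).toAffine.a₁ * uB +
        (V'.baseChange V.FunctionField).toAffine.a₃ = 0 := by ring
    rw [this, map_zero] at hunit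
    exact zero_ne_one hunit
  rw [Affine.Point.add_some hxy]
  exact poleIdx_some_of_le_one P _ (addX_le_one (integralCoeff_placeValuation P) hiA hiB
    (slope_le_one_of_tangent (integralCoeff_placeValuation P) hA.left hB.left hiA hiB
      (placeValuation_y_le_one hA.left hiA) hx hunit))

/-- **The order of `x(A) - x(B)` at a contact point** (`LOC` at a place): if `A = B + X` with
`X(P) = O'`, `x(B)` integral at `P` and `B(P) ∉ V'[2]` (`2y(B) + a₁x(B) + a₃` a unit at `P`),
then `ord_P(x(A) - x(B)) = e_X(P)`. [folklore] -/
theorem ord_sub_of_eq_add_pole (P : V.Point) {uA wA uB wB uX wX : V.FunctionField}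
    (hA : (V'.baseChange V.FunctionField).toAffine.Nonsingular uA wA)
    (hB : (V'.baseChange V.FunctionField).toAffine.Nonsingular uB wB)
    (hX : (V'.baseChange V.FunctionField).toAffine.Nonsingular uX wX) (huX : Transcendental k uX)
    (hX0 : specialize V V' P (.some uX wX hX) = 0) (hiB : placeValuation V P uB ≤ 1)
    (hunit : placeValuation V P (2 * wB + (V'.baseChange V.FunctionField).toAffine.a₁ * uB +
      (V'.baseChange V.FunctionField).toAffine.a₃) = 1)
    (hsum : (.some uA wA hA : (V'.baseChange V.FunctionField).toAffine.Point) =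
      .some uB wB hB + .some uX wX hX) :
    ord V P (uA - uB) = ramificationIdx V V' P hX huX := by
  have hu1 : 1 < placeValuation V P uX := (specialize_some_eq_zero_iff P hX).mp hX0
  have hne : uB ≠ uX := fun h ↦ by rw [h] at hiB; exact not_lt_of_ge hiB hu1
  rw [Affine.Point.add_of_X_ne hne, Affine.Point.some.injEq] at hsum
  rw [hsum.1, ← neg_neg (ramificationIdx V V' P hX huX : ℤ)]
  exact ord_eq_of_placeValuation_eq (placeValuation_addX_sub_eq P hX huX hX0 hB.left hiB hunit)

/-- **The pointwise identity behind the parallelogram law.** For affine `L`-points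
`A = (u_A, w_A)`, `B = (u_B, w_B)` of `V'` with `u_A ≠ u_B` and a place `P` of `L` such that
(1) `A(P)` and `B(P)` are not both `O'`, and (2) if `A`, `B` are integral at `P` with the same
reduced `x`-coordinate then `B(P) ∉ V'[2]`:
`ord_P(u_A - u_B) = -2ε_A(P) - 2ε_B(P) + ε_{A+B}(P) + ε_{A-B}(P)`.
(Cases: a pole of `A` or of `B`; distinct reduced `x`; same reduced `x`, where by the dichotomy
exactly one of `A ∓ B` has a pole at `P`, of ramification `ord_P(u_A - u_B)` by `LOC`.)
[folklore] -/
theorem ord_sub_eq_poleIdx (P : V.Point) {uA wA uB wB : V.FunctionField}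
    (hA : (V'.baseChange V.FunctionField).toAffine.Nonsingular uA wA)
    (hB : (V'.baseChange V.FunctionField).toAffine.Nonsingular uB wB) (hAB : uA ≠ uB)
    (h1 : ¬(specialize V V' P (.some uA wA hA) = 0 ∧ specialize V V' P (.some uB wB hB) = 0))
    (h2 : placeValuation V P uA ≤ 1 → placeValuation V P uB ≤ 1 →
      placeValuation V P (uA - uB) < 1 →
      placeValuation V P (2 * wB + (V'.baseChange V.FunctionField).toAffine.a₁ * uB +
        (V'.baseChange V.FunctionField).toAffine.a₃) = 1) :
    ord V P (uA - uB) =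
      -2 * poleIdx V V' P (.some uA wA hA) - 2 * poleIdx V V' P (.some uB wB hB) +
        poleIdx V V' P (.some uA wA hA + .some uB wB hB) +
        poleIdx V V' P (.some uA wA hA - .some uB wB hB) := by
  have hBn : (V'.baseChange V.FunctionField).toAffine.Nonsingular uB
      ((V'.baseChange V.FunctionField).toAffine.negY uB wB) :=
    (Affine.nonsingular_neg ..).mpr hB
  have hnegB : -(.some uB wB hB : (V'.baseChange V.FunctionField).toAffine.Point) =
      .some uB ((V'.baseChange V.FunctionField).toAffine.negY uB wB) hBn :=
    Affine.Point.neg_some hB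
  have hsub : (.some uA wA hA : (V'.baseChange V.FunctionField).toAffine.Point) - .some uB wB hB =
      .some uA wA hA + .some uB ((V'.baseChange V.FunctionField).toAffine.negY uB wB) hBn := by
    rw [sub_eq_add_neg, hnegB]
  by_cases hpA : 1 < placeValuation V P uA
  · -- `A` has a pole at `P`, so `B` is integral there
    have hA0 : specialize V V' P (.some uA wA hA) = 0 := (specialize_some_eq_zero_iff P hA).mpr hpA
    have huA := transcendental_of_one_lt hpA
    have hiB : placeValuation V P uB ≤ 1 := by
      by_contra h
      exact h1 ⟨hA0, (specialize_some_eq_zero_iff P hB).mpr (not_le.mp h)⟩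
    rw [ord_sub_of_pole P uB hA huA hA0 hiB, poleIdx_some_of_one_lt P hA hpA huA,
      poleIdx_some_of_le_one P hB hiB, add_comm (Affine.Point.some uA wA hA),
      poleIdx_add_of_pole P hA hA0 hB hiB, hsub, add_comm (Affine.Point.some uA wA hA),
      poleIdx_add_of_pole P hA hA0 hBn hiB]
    ring
  push Not at hpA
  by_cases hpB : 1 < placeValuation V P uB
  · -- `B` has a pole at `P`, `A` is integral there
    have hB0 : specialize V V' P (.some uB wB hB) = 0 := (specialize_some_eq_zero_iff P hB).mpr hpB
    have huB := transcendental_of_one_lt hpB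
    have hBn0 : specialize V V' P
        (.some uB ((V'.baseChange V.FunctionField).toAffine.negY uB wB) hBn) = 0 :=
      (specialize_some_eq_zero_iff P hBn).mpr hpB
    have e1 : ord V P (uA - uB) = -(2 * ramificationIdx V V' P hB huB : ℤ) := by
      rw [← ord_sub_of_pole P uA hB huB hB0 hpA, ord, ord, Valuation.map_sub_swap]
    have e2 : ramificationIdx V V' P hBn huB = ramificationIdx V V' P hB huB := by
      have h3 := (placeValuation_eq_exp_ramificationIdx P hBn huB hBn0).1
      rw [(placeValuation_eq_exp_ramificationIdx P hB huB hB0).1, WithZero.exp_inj] at h3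
      omega
    rw [e1, poleIdx_some_of_le_one P hA hpA, poleIdx_some_of_one_lt P hB hpB huB,
      poleIdx_add_of_pole P hB hB0 hA hpA, hsub, poleIdx_add_of_pole P hBn hBn0 hA hpA]
    ring
  push Not at hpB
  -- both integral
  rw [poleIdx_some_of_le_one P hA hpA, poleIdx_some_of_le_one P hB hpB]
  have hxle : placeValuation V P (uA - uB) ≤ 1 := Valuation.map_sub_le _ hpA hpB
  rcases hxle.eq_or_lt with hx1 | hxlt
  · -- distinct reduced `x`-coordinates
    rw [ord_eq_of_placeValuation_eq (n := 0) (by rw [hx1, WithZero.exp_zero]),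
      poleIdx_add_of_sub_eq_one P hA hB hpA hpB hx1, hsub,
      poleIdx_add_of_sub_eq_one P hA hBn hpA hpB hx1]
    ring
  -- the same reduced `x`-coordinate
  have hunit := h2 hpA hpB hxlt
  have hunit' : placeValuation V P (2 * (V'.baseChange V.FunctionField).toAffine.negY uB wB +
      (V'.baseChange V.FunctionField).toAffine.a₁ * uB +
      (V'.baseChange V.FunctionField).toAffine.a₃) = 1 := by
    rw [← hunit, ← Valuation.map_neg, Affine.negY]
    congr 1; ring
  have hwA := placeValuation_y_le_one hA.left hpA
  have hwB := placeValuation_y_le_one hB.left hpB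
  rcases unit_dichotomy (integralCoeff_placeValuation P) hA.left hB.left hpA hpB hwA hwB hxlt
    hunit with hop | htan
  · -- opposite type: `A + B` has the pole
    have hS0 := specialize_add_of_opposite P hA hB hpA hpB hxlt hop
    have hSne : (.some uA wA hA : (V'.baseChange V.FunctionField).toAffine.Point) +
        .some uB wB hB ≠ 0 := by
      intro h0
      have := eq_neg_of_add_eq_zero_left h0
      rw [hnegB, Affine.Point.some.injEq] at this
      exact hAB this.1
    obtain ⟨uX, wX, hX, hXe⟩ := Point.exists_eq_some hSne
    rw [hXe] at hS0 ⊢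
    have hpX : 1 < placeValuation V P uX := (specialize_some_eq_zero_iff P hX).mp hS0
    have huX := transcendental_of_one_lt hpX
    have htan' : placeValuation V P (wA + (V'.baseChange V.FunctionField).toAffine.negY uB wB +
        (V'.baseChange V.FunctionField).toAffine.a₁ * uB +
        (V'.baseChange V.FunctionField).toAffine.a₃) = 1 := by
      rw [← hop, Affine.negY]; congr 1; ring
    rw [poleIdx_some_of_one_lt P hX hpX huX, hsub,
      poleIdx_add_of_tangent P hA hBn hpA hpB hxlt htan',
      ord_sub_of_eq_add_pole P hA hBn hX huX hS0 hpB hunit' (by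
        rw [← hXe, ← hnegB]; abel)]
    ring
  · -- tangent type: `A - B` has the pole
    have hop' : placeValuation V P
        (wA - (V'.baseChange V.FunctionField).toAffine.negY uB wB) = 1 := by
      rw [← htan, Affine.negY]; congr 1; ring
    have hS0 := specialize_add_of_opposite P hA hBn hpA hpB hxlt hop'
    have hSne : (.some uA wA hA : (V'.baseChange V.FunctionField).toAffine.Point) +
        .some uB ((V'.baseChange V.FunctionField).toAffine.negY uB wB) hBn ≠ 0 := by
      intro h0
      have := eq_neg_of_add_eq_zero_left h0
      rw [Affine.Point.neg_some, Affine.Point.some.injEq] at this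
      exact hAB this.1
    obtain ⟨uX, wX, hX, hXe⟩ := Point.exists_eq_some hSne
    rw [hXe] at hS0
    have hpX : 1 < placeValuation V P uX := (specialize_some_eq_zero_iff P hX).mp hS0
    have huX := transcendental_of_one_lt hpX
    rw [poleIdx_add_of_tangent P hA hB hpA hpB hxlt htan, hsub, hXe,
      poleIdx_some_of_one_lt P hX hpX huX,
      ord_sub_of_eq_add_pole P hA hB hX huX hS0 hpB hunit (by
        rw [← hXe, ← hsub, add_sub_cancel])]
    ring

/-! ## The polar degree `d(X)` and the parallelogram law under genericity hypotheses -/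

variable (V V') in
/-- **The polar degree `d(X)`** of an `L`-point `X` of `V'`: the degree
`Σ_{P : X(P) = O'} e_X(P)` of the fibre of `X` over `O'` for non-constant affine `X`, and `0`
for `X = O` and for constant `X` (whose `x`-coordinate has no pole). For the generic image of a
morphism `φ : V → V'` this is `Σ_{P ∈ φ⁻¹(O')} e_φ(P) = deg φ`. Silverman, *AEC*,
Prop. II.2.6(a). [folklore] -/
def polarDeg [IsAlgClosed k] : (V'.baseChange V.FunctionField).toAffine.Point → ℕ
  | .zero => 0
  | .some u _ h => if hu : Transcendental k u then fibreDegree V V' h hu 0 else 0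

/-- `d(O) = 0`. [folklore] -/
theorem polarDeg_zero [IsAlgClosed k] :
    polarDeg V V' (0 : (V'.baseChange V.FunctionField).toAffine.Point) = 0 := rfl

/-- `d(X)` for non-constant affine `X`. [folklore] -/
theorem polarDeg_some_of_transcendental [IsAlgClosed k] {u w : V.FunctionField}
    (h : (V'.baseChange V.FunctionField).toAffine.Nonsingular u w) (hu : Transcendental k u) :
    polarDeg V V' (.some u w h) = fibreDegree V V' h hu 0 := by
  rw [polarDeg, dif_pos hu]

/-- `d(X) = 0` for constant `X`. [folklore] -/
theorem polarDeg_some_of_not_transcendental [IsAlgClosed k] {u w : V.FunctionField}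
    (h : (V'.baseChange V.FunctionField).toAffine.Nonsingular u w) (hu : ¬Transcendental k u) :
    polarDeg V V' (.some u w h) = 0 := by
  rw [polarDeg, dif_neg hu]

/-- `ε_X(P) = 0` for constant `X`. [folklore] -/
theorem poleIdx_some_of_not_transcendental (P : V.Point) {u w : V.FunctionField}
    (h : (V'.baseChange V.FunctionField).toAffine.Nonsingular u w) (hu : ¬Transcendental k u) :
    poleIdx V V' P (.some u w h) = 0 := by
  rw [poleIdx]
  split_ifs with h1
  · exact absurd (transcendental_of_one_lt h1) hu
  · rfl

/-- `P ↦ ε_X(P)` has finite support. [folklore] -/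
theorem finite_support_poleIdx [IsAlgClosed k]
    (X : (V'.baseChange V.FunctionField).toAffine.Point) :
    (Function.support fun P ↦ (poleIdx V V' P X : ℤ)).Finite := by
  cases X with
  | zero => simp
  | some u w h =>
    by_cases hu : Transcendental k u
    · refine (finite_fibre_specialize h hu 0).subset fun P hP ↦ ?_
      rw [Function.mem_support] at hP
      rw [Set.mem_setOf_eq, specialize_some_eq_zero_iff]
      by_contra h1
      exact hP (by rw [poleIdx_some_of_le_one P h (not_lt.mp h1)]; rfl)
    · have : (Function.support fun P ↦ (poleIdx V V' P (.some u w h) : ℤ)) = ∅ := by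
        ext P
        simp [poleIdx_some_of_not_transcendental P h hu]
      rw [this]
      exact Set.finite_empty

/-- **`Σ_P ε_X(P) = d(X)`.** [folklore] -/
theorem finsum_poleIdx [IsAlgClosed k] (X : (V'.baseChange V.FunctionField).toAffine.Point) :
    ∑ᶠ P, (poleIdx V V' P X : ℤ) = polarDeg V V' X := by
  cases X with
  | zero => simp [polarDeg]
  | some u w h =>
    by_cases hu : Transcendental k u
    · rw [polarDeg_some_of_transcendental h hu, cast_fibreDegree h hu 0]
      refine finsum_congr fun P ↦ ?_
      by_cases h1 : 1 < placeValuation V P u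
      · rw [poleIdx_some_of_one_lt P h h1 hu, if_pos ((specialize_some_eq_zero_iff P h).mpr h1)]
      · rw [poleIdx_some_of_le_one P h (not_lt.mp h1),
          if_neg (fun h0 ↦ h1 ((specialize_some_eq_zero_iff P h).mp h0))]
        rfl
    · rw [polarDeg_some_of_not_transcendental h hu]
      simp [poleIdx_some_of_not_transcendental _ h hu]

/-- **The parallelogram law under genericity hypotheses**: for affine `L`-points `A`, `B` of
`V'` with `x(A) ≠ x(B)`, no common point in their fibres over `O'`, and `B(P) ∉ V'[2]` wherever
`A`, `B` are integral with the same reduced `x`-coordinate,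
`d(A + B) + d(A - B) = 2d(A) + 2d(B)`: sum the pointwise identity `ord_sub_eq_poleIdx` over all
places and use `deg div (x(A) - x(B)) = 0`. Silverman, *AEC*, III.6.2–6.3 (for isogenies,
via the dual isogeny); here by counting poles. [folklore] -/
theorem polarDeg_parallelogram_of_generic [IsAlgClosed k] {uA wA uB wB : V.FunctionField}
    (hA : (V'.baseChange V.FunctionField).toAffine.Nonsingular uA wA)
    (hB : (V'.baseChange V.FunctionField).toAffine.Nonsingular uB wB) (hAB : uA ≠ uB)
    (h1 : ∀ P, ¬(specialize V V' P (.some uA wA hA) = 0 ∧ specialize V V' P (.some uB wB hB) = 0))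
    (h2 : ∀ P, placeValuation V P uA ≤ 1 → placeValuation V P uB ≤ 1 →
      placeValuation V P (uA - uB) < 1 →
      placeValuation V P (2 * wB + (V'.baseChange V.FunctionField).toAffine.a₁ * uB +
        (V'.baseChange V.FunctionField).toAffine.a₃) = 1) :
    (polarDeg V V' (.some uA wA hA + .some uB wB hB) : ℤ) +
        polarDeg V V' (.some uA wA hA - .some uB wB hB) =
      2 * polarDeg V V' (.some uA wA hA) + 2 * polarDeg V V' (.some uB wB hB) := by
  set A : (V'.baseChange V.FunctionField).toAffine.Point := .some uA wA hA with hAdef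
  set B : (V'.baseChange V.FunctionField).toAffine.Point := .some uB wB hB with hBdef
  have hsum := finsum_ord (V := V) (sub_ne_zero.mpr hAB)
  have hpt : ∀ P, ord V P (uA - uB) = -2 * (poleIdx V V' P A : ℤ) - 2 * (poleIdx V V' P B : ℤ) +
      (poleIdx V V' P (A + B) : ℤ) + (poleIdx V V' P (A - B) : ℤ) := fun P ↦
    ord_sub_eq_poleIdx P hA hB hAB (h1 P) (h2 P)
  obtain ⟨S, hS⟩ : ∃ S : Finset V.Point, ∀ X ∈ [A, B, A + B, A - B],
      (Function.support fun P ↦ (poleIdx V V' P X : ℤ)) ⊆ S := by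
    refine ⟨((finite_support_poleIdx A).union (finite_support_poleIdx B)).union
      ((finite_support_poleIdx (A + B)).union (finite_support_poleIdx (A - B))) |>.toFinset, ?_⟩
    intro X hX
    simp only [List.mem_cons, List.not_mem_nil, or_false] at hX
    intro P hP
    simp only [Set.Finite.coe_toFinset, Set.mem_union]
    rcases hX with rfl | rfl | rfl | rfl
    · exact Or.inl (Or.inl hP)
    · exact Or.inl (Or.inr hP)
    · exact Or.inr (Or.inl hP)
    · exact Or.inr (Or.inr hP)
  have hSA := hS A (by simp)
  have hSB := hS B (by simp)
  have hSp := hS (A + B) (by simp)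
  have hSm := hS (A - B) (by simp)
  have hsuppF : (Function.support fun P ↦ ord V P (uA - uB)) ⊆ S := by
    intro P hP
    rw [Function.mem_support, hpt P] at hP
    by_contra hPS
    have zA : (poleIdx V V' P A : ℤ) = 0 := by_contra fun h ↦ hPS (hSA h)
    have zB : (poleIdx V V' P B : ℤ) = 0 := by_contra fun h ↦ hPS (hSB h)
    have zp : (poleIdx V V' P (A + B) : ℤ) = 0 := by_contra fun h ↦ hPS (hSp h)
    have zm : (poleIdx V V' P (A - B) : ℤ) = 0 := by_contra fun h ↦ hPS (hSm h)
    rw [zA, zB, zp, zm] at hP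
    exact hP (by ring)
  rw [finsum_eq_sum_of_support_subset _ hsuppF, Finset.sum_congr rfl fun P _ ↦ hpt P,
    Finset.sum_add_distrib, Finset.sum_add_distrib, Finset.sum_sub_distrib, ← Finset.mul_sum,
    ← Finset.mul_sum, ← finsum_eq_sum_of_support_subset _ hSA,
    ← finsum_eq_sum_of_support_subset _ hSB, ← finsum_eq_sum_of_support_subset _ hSp,
    ← finsum_eq_sum_of_support_subset _ hSm, finsum_poleIdx, finsum_poleIdx, finsum_poleIdx,
    finsum_poleIdx] at hsum
  linarith

end Places

section SpecAdd

variable {V : WeierstrassCurve.Affine k} [V.IsElliptic] {V' : WeierstrassCurve.Affine k}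
  [V'.IsElliptic]

/-! ## Residues of the coefficients -/

omit [V.IsElliptic] [V'.IsElliptic] in
/-- `a₁` of `V'/L` is the constant `a₁`. [folklore] -/
theorem baseChange_a₁ : (V'.baseChange V.FunctionField).toAffine.a₁ =
    algebraMap k V.FunctionField V'.a₁ := rfl

omit [V.IsElliptic] [V'.IsElliptic] in
/-- `a₂` of `V'/L` is the constant `a₂`. [folklore] -/
theorem baseChange_a₂ : (V'.baseChange V.FunctionField).toAffine.a₂ =
    algebraMap k V.FunctionField V'.a₂ := rfl

omit [V.IsElliptic] [V'.IsElliptic] in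
/-- `a₃` of `V'/L` is the constant `a₃`. [folklore] -/
theorem baseChange_a₃ : (V'.baseChange V.FunctionField).toAffine.a₃ =
    algebraMap k V.FunctionField V'.a₃ := rfl

omit [V.IsElliptic] [V'.IsElliptic] in
/-- `a₄` of `V'/L` is the constant `a₄`. [folklore] -/
theorem baseChange_a₄ : (V'.baseChange V.FunctionField).toAffine.a₄ =
    algebraMap k V.FunctionField V'.a₄ := rfl

omit [V.IsElliptic] [V'.IsElliptic] in
/-- `a₆` of `V'/L` is the constant `a₆`. [folklore] -/
theorem baseChange_a₆ : (V'.baseChange V.FunctionField).toAffine.a₆ =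
    algebraMap k V.FunctionField V'.a₆ := rfl

/-! ## Residues of chords: specialisation is additive at good places -/

omit [V'.IsElliptic] in
/-- **Residue of the slope** through integral points with distinct reduced `x`-coordinates: the
slope of the residues. [folklore] -/
theorem placeValuation_slope_le_one_and_placeRes [DecidableEq k] (P : V.Point)
    {uA wA uB wB : V.FunctionField}
    (hA : (V'.baseChange V.FunctionField).toAffine.Equation uA wA)
    (hB : (V'.baseChange V.FunctionField).toAffine.Equation uB wB)
    (hiA : placeValuation V P uA ≤ 1) (hiB : placeValuation V P uB ≤ 1)
    (hx : placeValuation V P (uA - uB) = 1) :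
    placeValuation V P ((V'.baseChange V.FunctionField).toAffine.slope uA uB wA wB) ≤ 1 ∧
      placeRes V P ((V'.baseChange V.FunctionField).toAffine.slope uA uB wA wB) =
        V'.slope (placeRes V P uA) (placeRes V P uB) (placeRes V P wA) (placeRes V P wB) := by
  have hne : uA ≠ uB := fun h ↦ by rw [h, sub_self, map_zero] at hx; exact zero_ne_one hx
  have hwA := placeValuation_y_le_one hA hiA
  have hwB := placeValuation_y_le_one hB hiB
  have hxle : placeValuation V P (uA - uB) ≤ 1 := hx.le
  have hres : placeRes V P (uA - uB) ≠ 0 := (placeValuation_eq_one_iff P hxle).mp hx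
  have hne' : placeRes V P uA ≠ placeRes V P uB := by
    rw [placeRes_sub P hiA hiB] at hres; exact sub_ne_zero.mp hres
  have hinv : placeValuation V P (uA - uB)⁻¹ ≤ 1 := by rw [map_inv₀, hx, inv_one]
  rw [Affine.slope_of_X_ne hne, Affine.slope_of_X_ne hne', div_eq_mul_inv, div_eq_mul_inv]
  refine ⟨by rw [map_mul]; exact mul_le_one' (Valuation.map_sub_le _ hwA hwB) hinv, ?_⟩
  rw [placeRes_mul P (Valuation.map_sub_le _ hwA hwB) hinv, placeRes_inv P hxle hres,
    placeRes_sub P hwA hwB, placeRes_sub P hiA hiB]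

omit [V'.IsElliptic] in
/-- **Residue of `x₃ = λ² + a₁λ - a₂ - x₁ - x₂`** for integral arguments. [folklore] -/
theorem placeValuation_addX_le_one_and_placeRes (P : V.Point) {x₁ x₂ ℓ : V.FunctionField}
    (h₁ : placeValuation V P x₁ ≤ 1) (h₂ : placeValuation V P x₂ ≤ 1)
    (hℓ : placeValuation V P ℓ ≤ 1) :
    placeValuation V P ((V'.baseChange V.FunctionField).toAffine.addX x₁ x₂ ℓ) ≤ 1 ∧
      placeRes V P ((V'.baseChange V.FunctionField).toAffine.addX x₁ x₂ ℓ) =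
        V'.addX (placeRes V P x₁) (placeRes V P x₂) (placeRes V P ℓ) := by
  refine ⟨addX_le_one (integralCoeff_placeValuation P) h₁ h₂ hℓ, ?_⟩
  obtain ⟨ha₁, ha₂, -, -, -⟩ := placeValuation_baseChange_a_le_one (V' := V') P
  have hℓ2 : placeValuation V P (ℓ ^ 2) ≤ 1 := by rw [map_pow]; exact pow_le_one₀ zero_le hℓ
  have ha1ℓ : placeValuation V P ((V'.baseChange V.FunctionField).toAffine.a₁ * ℓ) ≤ 1 := by
    rw [map_mul]; exact mul_le_one' ha₁ hℓ
  have h12 : placeValuation V P (ℓ ^ 2 + (V'.baseChange V.FunctionField).toAffine.a₁ * ℓ) ≤ 1 :=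
    (Valuation.map_add _ _ _).trans (max_le hℓ2 ha1ℓ)
  have h123 : placeValuation V P (ℓ ^ 2 + (V'.baseChange V.FunctionField).toAffine.a₁ * ℓ -
      (V'.baseChange V.FunctionField).toAffine.a₂) ≤ 1 := Valuation.map_sub_le _ h12 ha₂
  have h1234 : placeValuation V P (ℓ ^ 2 + (V'.baseChange V.FunctionField).toAffine.a₁ * ℓ -
      (V'.baseChange V.FunctionField).toAffine.a₂ - x₁) ≤ 1 := Valuation.map_sub_le _ h123 h₁
  rw [Affine.addX, Affine.addX, placeRes_sub P h1234 h₂, placeRes_sub P h123 h₁,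
    placeRes_sub P h12 ha₂, placeRes_add P hℓ2 ha1ℓ, placeRes_mul P ha₁ hℓ, pow_two,
    placeRes_mul P hℓ hℓ, baseChange_a₁, baseChange_a₂, placeRes_algebraMap, placeRes_algebraMap]
  ring

omit [V'.IsElliptic] in
/-- **Residue of `y₃ = -(λ(x₃ - x₁) + y₁) - a₁x₃ - a₃`** for integral arguments. [folklore] -/
theorem placeValuation_addY_le_one_and_placeRes (P : V.Point) {x₁ x₂ y₁ ℓ : V.FunctionField}
    (h₁ : placeValuation V P x₁ ≤ 1) (h₂ : placeValuation V P x₂ ≤ 1)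
    (hy₁ : placeValuation V P y₁ ≤ 1) (hℓ : placeValuation V P ℓ ≤ 1) :
    placeValuation V P ((V'.baseChange V.FunctionField).toAffine.addY x₁ x₂ y₁ ℓ) ≤ 1 ∧
      placeRes V P ((V'.baseChange V.FunctionField).toAffine.addY x₁ x₂ y₁ ℓ) =
        V'.addY (placeRes V P x₁) (placeRes V P x₂) (placeRes V P y₁) (placeRes V P ℓ) := by
  refine ⟨addY_le_one (integralCoeff_placeValuation P) h₁ h₂ hy₁ hℓ, ?_⟩
  obtain ⟨hX, hXr⟩ := placeValuation_addX_le_one_and_placeRes (V' := V') P h₁ h₂ hℓ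
  obtain ⟨ha₁, -, ha₃, -, -⟩ := placeValuation_baseChange_a_le_one (V' := V') P
  set x₃ := (V'.baseChange V.FunctionField).toAffine.addX x₁ x₂ ℓ with hx₃
  have h31 : placeValuation V P (x₃ - x₁) ≤ 1 := Valuation.map_sub_le _ hX h₁
  have hl31 : placeValuation V P (ℓ * (x₃ - x₁)) ≤ 1 := by
    rw [map_mul]; exact mul_le_one' hℓ h31
  have hna : placeValuation V P (ℓ * (x₃ - x₁) + y₁) ≤ 1 :=
    (Valuation.map_add _ _ _).trans (max_le hl31 hy₁)
  have hneg : placeValuation V P (-(ℓ * (x₃ - x₁) + y₁)) ≤ 1 := by rwa [Valuation.map_neg]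
  have ha1x : placeValuation V P ((V'.baseChange V.FunctionField).toAffine.a₁ * x₃) ≤ 1 := by
    rw [map_mul]; exact mul_le_one' ha₁ hX
  have hm : placeValuation V P (-(ℓ * (x₃ - x₁) + y₁) -
      (V'.baseChange V.FunctionField).toAffine.a₁ * x₃) ≤ 1 := Valuation.map_sub_le _ hneg ha1x
  rw [Affine.addY, Affine.negY, Affine.negAddY, ← hx₃, Affine.addY, Affine.negY, Affine.negAddY,
    placeRes_sub P hm ha₃, placeRes_sub P hneg ha1x, placeRes_neg P hna, placeRes_add P hl31 hy₁,
    placeRes_mul P hℓ h31, placeRes_sub P hX h₁, placeRes_mul P ha₁ hX, hXr, baseChange_a₁,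
    baseChange_a₃, placeRes_algebraMap, placeRes_algebraMap]

/-- **Specialisation is additive at a place where both points are integral with distinct
reduced `x`-coordinates.** Silverman, *AEC*, VII.2.1 (reduction is a homomorphism).
[folklore] -/
theorem specialize_add_of_sub_eq_one [DecidableEq k] (P : V.Point)
    {uA wA uB wB : V.FunctionField}
    (hA : (V'.baseChange V.FunctionField).toAffine.Nonsingular uA wA)
    (hB : (V'.baseChange V.FunctionField).toAffine.Nonsingular uB wB)
    (hiA : placeValuation V P uA ≤ 1) (hiB : placeValuation V P uB ≤ 1)
    (hx : placeValuation V P (uA - uB) = 1) :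
    specialize V V' P (.some uA wA hA + .some uB wB hB) =
      specialize V V' P (.some uA wA hA) + specialize V V' P (.some uB wB hB) := by
  have hne : uA ≠ uB := fun h ↦ by rw [h, sub_self, map_zero] at hx; exact zero_ne_one hx
  obtain ⟨hsl, hslr⟩ := placeValuation_slope_le_one_and_placeRes P hA.left hB.left hiA hiB hx
  obtain ⟨hX3, hX3r⟩ := placeValuation_addX_le_one_and_placeRes (V' := V') P hiA hiB hsl
  obtain ⟨hY3, hY3r⟩ := placeValuation_addY_le_one_and_placeRes (V' := V') P hiA hiB
    (placeValuation_y_le_one hA.left hiA) hsl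
  have hres : placeRes V P (uA - uB) ≠ 0 := (placeValuation_eq_one_iff P hx.le).mp hx
  have hne' : placeRes V P uA ≠ placeRes V P uB := by
    rw [placeRes_sub P hiA hiB] at hres; exact sub_ne_zero.mp hres
  rw [Affine.Point.add_of_X_ne hne, specialize_some_of_le_one P _ hX3,
    specialize_some_of_le_one P hA hiA, specialize_some_of_le_one P hB hiB,
    Affine.Point.add_of_X_ne hne', Affine.Point.some.injEq]
  exact ⟨by rw [hX3r, hslr], by rw [hY3r, hslr]⟩

/-! ## Constant `L`-points -/

variable (V V') in
/-- **The constant `L`-point `R_L`** of `V'` defined by a point `R ∈ V'(k)`. [folklore] -/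
def constL : V'.Point → (V'.baseChange V.FunctionField).toAffine.Point
  | .zero => 0
  | .some a b h => .some (algebraMap k V.FunctionField a) (algebraMap k V.FunctionField b)
      ((Affine.map_nonsingular V' (FaithfulSMul.algebraMap_injective k V.FunctionField) a b).mpr h)

omit [V.IsElliptic] [V'.IsElliptic] in
/-- `O_L = O`. [folklore] -/
theorem constL_zero : constL V V' 0 = 0 := rfl

omit [V.IsElliptic] [V'.IsElliptic] in
/-- `(a, b)_L = (a, b)`. [folklore] -/
theorem constL_some {a b : k} (h : V'.Nonsingular a b) :
    constL V V' (.some a b h) = .some (algebraMap k V.FunctionField a)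
      (algebraMap k V.FunctionField b) ((Affine.map_nonsingular V'
        (FaithfulSMul.algebraMap_injective k V.FunctionField) a b).mpr h) := rfl

omit [V.IsElliptic] [V'.IsElliptic] in
/-- `negY` of constants is constant. [folklore] -/
theorem baseChange_negY_algebraMap (a b : k) :
    (V'.baseChange V.FunctionField).toAffine.negY (algebraMap k V.FunctionField a)
      (algebraMap k V.FunctionField b) = algebraMap k V.FunctionField (V'.negY a b) :=
  Affine.map_negY (W' := V') (algebraMap k V.FunctionField) a b

omit [V.IsElliptic] [V'.IsElliptic] in
/-- `(-R)_L = -R_L`. [folklore] -/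
theorem constL_neg (R : V'.Point) : constL V V' (-R) = -constL V V' R := by
  cases R with
  | zero => rfl
  | some a b h =>
    rw [Affine.Point.neg_some, constL_some, constL_some, Affine.Point.neg_some,
      Affine.Point.some.injEq]
    exact ⟨rfl, (baseChange_negY_algebraMap a b).symm⟩

omit [V.IsElliptic] [V'.IsElliptic] in
/-- `R ↦ R_L` is injective. [folklore] -/
theorem constL_injective : Function.Injective (constL V V') := by
  rintro (_ | ⟨a, b, h⟩) (_ | ⟨a', b', h'⟩) hRS
  · rfl
  · exact absurd hRS.symm (Affine.Point.some_ne_zero _)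
  · exact absurd hRS (Affine.Point.some_ne_zero _)
  · rw [constL_some, constL_some, Affine.Point.some.injEq] at hRS
    obtain ⟨ha, hb⟩ := hRS
    have hinj := FaithfulSMul.algebraMap_injective k V.FunctionField
    cases hinj ha; cases hinj hb; rfl

/-- Constants are integral. [folklore] -/
theorem placeValuation_algebraMap_le_one (P : V.Point) (c : k) :
    placeValuation V P (algebraMap k V.FunctionField c) ≤ 1 := by
  by_cases hc : c = 0
  · simp [hc]
  · exact (placeValuation_algebraMap P hc).le

/-- **`R_L(P) = R` at every place.** [folklore] -/
theorem specialize_constL (P : V.Point) (R : V'.Point) : specialize V V' P (constL V V' R) = R := by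
  cases R with
  | zero => rfl
  | some a b h =>
    rw [constL_some, specialize_some_of_le_one P _ (placeValuation_algebraMap_le_one P a),
      Affine.Point.some.injEq]
    exact ⟨placeRes_algebraMap P a, placeRes_algebraMap P b⟩

/-- `ε_{R_L}(P) = 0`. [folklore] -/
theorem poleIdx_constL (P : V.Point) (R : V'.Point) : poleIdx V V' P (constL V V' R) = 0 := by
  cases R with
  | zero => rfl
  | some a b h => exact poleIdx_some_of_le_one P _ (placeValuation_algebraMap_le_one P a)

omit [V.IsElliptic] in
/-- Constants are algebraic. [folklore] -/
theorem not_transcendental_algebraMap (c : k) :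
    ¬Transcendental k (algebraMap k V.FunctionField c) :=
  fun h ↦ h (isAlgebraic_algebraMap c)

/-- `d(R_L) = 0`. [folklore] -/
theorem polarDeg_constL [IsAlgClosed k] (R : V'.Point) : polarDeg V V' (constL V V' R) = 0 := by
  cases R with
  | zero => rfl
  | some a b h => exact polarDeg_some_of_not_transcendental _ (not_transcendental_algebraMap a)

end SpecAdd

section Translation

variable {V : WeierstrassCurve.Affine k} [V.IsElliptic] {V' : WeierstrassCurve.Affine k}
  [V'.IsElliptic]

/-! ## Translation by a constant point preserves the polar degree -/

omit [V.IsElliptic] in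
/-- **`ord_{Q₀}(x' - a) = 1` at a point `Q₀ = (a, b₀) ∉ V'[2]`** (`div (x' - a) = (Q₀) + (-Q₀) -
2(O)` with `Q₀ ≠ -Q₀`). Silverman, *AEC*, II.3.5. [folklore] -/
theorem ord_xSubC_eq_one [IsAlgClosed k] {a b₀ : k} (h₀ : V'.Nonsingular a b₀)
    (h2 : b₀ ≠ V'.negY a b₀) :
    ord V' (.some a b₀ h₀) (algebraMap V'.CoordinateRing V'.FunctionField (xSubC V' a)) = 1 := by
  classical
  have key := finsum_ord_xSubC_mul (V' := V')
    (fun Q ↦ if Q = Affine.Point.some a b₀ h₀ then (1 : ℤ) else 0) h₀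
  rw [finsum_eq_single _ (Affine.Point.some a b₀ h₀)
    (fun Q hQ ↦ by simp only [if_neg hQ, mul_zero])] at key
  have hne : -Affine.Point.some a b₀ h₀ ≠ Affine.Point.some a b₀ h₀ := by
    rw [Affine.Point.neg_some]
    intro h
    rw [Affine.Point.some.injEq] at h
    exact h2 h.2.symm
  have h0 : (0 : V'.Point) ≠ Affine.Point.some a b₀ h₀ := fun h ↦ Affine.Point.some_ne_zero _ h.symm
  rw [if_pos rfl, if_neg h0, if_neg hne] at key
  linarith

omit [V.IsElliptic] [V'.IsElliptic] in
/-- `x' - a ∈ k(V')` is the image of `xSubC a ∈ k[V']`. [folklore] -/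
theorem algebraMap_xSubC (a : k) :
    algebraMap V'.CoordinateRing V'.FunctionField (xSubC V' a) =
      xF V' - algebraMap k V'.FunctionField a := by
  change algebraMap V'.CoordinateRing V'.FunctionField (algebraMap k[X] V'.CoordinateRing
    (X - C a)) = algebraMap k[X] V'.FunctionField X - _
  rw [← IsScalarTower.algebraMap_apply, map_sub, IsScalarTower.algebraMap_apply k k[X]
    V'.FunctionField a, Polynomial.algebraMap_eq]

/-- Over an algebraically closed field, algebraic elements of an extension are constants.
[folklore] -/
theorem exists_algebraMap_eq_of_isAlgebraic' [IsAlgClosed k] {F : Type*} [Field F] [Algebra k F]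
    {u : F} (hu : IsAlgebraic k u) : ∃ a : k, algebraMap k F a = u := by
  have h1 : (minpoly k u).degree = 1 :=
    IsAlgClosed.degree_eq_one_of_irreducible _ (minpoly.irreducible hu.isIntegral)
  exact minpoly.mem_range_of_degree_eq_one _ _ h1

omit [V'.IsElliptic] in
/-- `2b + a₁a + a₃`, as a constant of `L`, is a unit at every place if `(a, b) ∉ V'[2]`.
[folklore] -/
theorem placeValuation_two_mul_add_eq_one (P : V.Point) {a b : k} (h2 : b ≠ V'.negY a b) :
    placeValuation V P (2 * algebraMap k V.FunctionField b +
      (V'.baseChange V.FunctionField).toAffine.a₁ * algebraMap k V.FunctionField a +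
      (V'.baseChange V.FunctionField).toAffine.a₃) = 1 := by
  have hne : 2 * b + V'.a₁ * a + V'.a₃ ≠ 0 := fun h0 ↦ h2 (by
    rw [Affine.negY]; linear_combination h0)
  rw [baseChange_a₁, baseChange_a₃, ← map_ofNat (algebraMap k V.FunctionField) 2, ← map_mul,
    ← map_mul, ← map_add, ← map_add]
  exact placeValuation_algebraMap P hne

/-- **Poles of `X + R_L`, pointwise**: for a non-constant affine `L`-point `X` and
`R = (a, b) ∈ V'(k) ∖ V'[2]`, `ε_{X + R_L}(P) = e_X(P)` if `X(P) = -R` and `0` otherwise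
(pole of `X`: `X + R_L` integral; distinct reduced `x`: integral; same reduced `x`: the
dichotomy, and at a pole `ord_P(x(X) - a) = e_{X+R_L}(P)` by `LOC` while
`ord_P(x(X) - a) = e_X(P) ord_{-R}(x' - a) = e_X(P)`). [folklore] -/
theorem poleIdx_add_constL [IsAlgClosed k] (P : V.Point) {u w : V.FunctionField}
    (h : (V'.baseChange V.FunctionField).toAffine.Nonsingular u w) (hu : Transcendental k u)
    {a b : k} (hR : V'.Nonsingular a b) (h2 : b ≠ V'.negY a b) :
    (poleIdx V V' P (.some u w h + constL V V' (.some a b hR)) : ℤ) =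
      if specialize V V' P (.some u w h) = -.some a b hR then (ramificationIdx V V' P h hu : ℤ)
      else 0 := by
  classical
  have hRn : (V'.baseChange V.FunctionField).toAffine.Nonsingular (algebraMap k V.FunctionField a)
      (algebraMap k V.FunctionField b) :=
    (Affine.map_nonsingular V' (FaithfulSMul.algebraMap_injective k V.FunctionField) a b).mpr hR
  have hRL : constL V V' (.some a b hR) = .some _ _ hRn := constL_some hR
  have hia := placeValuation_algebraMap_le_one (V := V) P a
  have hib := placeValuation_algebraMap_le_one (V := V) P b
  have hunitR := placeValuation_two_mul_add_eq_one (V := V) (V' := V') P h2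
  have hnegR : -(Affine.Point.some a b hR) = .some a (V'.negY a b)
      ((Affine.nonsingular_neg ..).mpr hR) := Affine.Point.neg_some hR
  by_cases hpu : 1 < placeValuation V P u
  · -- pole of `X`
    have hX0 := (specialize_some_eq_zero_iff P h).mpr hpu
    rw [hRL, add_comm, poleIdx_add_of_pole P h hX0 hRn hia, hX0, hnegR,
      if_neg (fun h0 ↦ Affine.Point.some_ne_zero _ h0.symm), Nat.cast_zero]
  push Not at hpu
  have hwi := placeValuation_y_le_one h.left hpu
  by_cases hx1 : placeValuation V P (u - algebraMap k V.FunctionField a) = 1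
  · -- distinct reduced `x`
    rw [hRL, poleIdx_add_of_sub_eq_one P h hRn hpu hia hx1, specialize_some_of_le_one P h hpu,
      hnegR, if_neg, Nat.cast_zero]
    intro heq
    rw [Affine.Point.some.injEq] at heq
    have hres : placeRes V P (u - algebraMap k V.FunctionField a) ≠ 0 :=
      (placeValuation_eq_one_iff P hx1.le).mp hx1
    rw [placeRes_sub P hpu hia, placeRes_algebraMap, heq.1, sub_self] at hres
    exact hres rfl
  -- the same reduced `x`
  have hxlt : placeValuation V P (u - algebraMap k V.FunctionField a) < 1 :=
    lt_of_le_of_ne (Valuation.map_sub_le _ hpu hia) hx1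
  have hres : placeRes V P u = a := by
    have := (placeRes_eq_zero_iff P (Valuation.map_sub_le _ hpu hia)).mpr hxlt
    rwa [placeRes_sub P hpu hia, placeRes_algebraMap, sub_eq_zero] at this
  have hwres : placeRes V P w = b ∨ placeRes V P w = V'.negY a b :=
    Affine.Y_eq_of_X_eq (equation_placeRes h.left hpu) hR.left hres
  rcases unit_dichotomy (integralCoeff_placeValuation P) h.left hRn.left hpu hia hwi hib hxlt
    hunitR with hop | htan
  · -- opposite type: `X + R_L` has a pole, `X(P) = -R`
    have hS0 := specialize_add_of_opposite P h hRn hpu hia hxlt hop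
    have hSne : (.some u w h : (V'.baseChange V.FunctionField).toAffine.Point) +
        .some _ _ hRn ≠ 0 := by
      intro h0
      have := eq_neg_of_add_eq_zero_left h0
      rw [Affine.Point.neg_some, Affine.Point.some.injEq] at this
      rw [this.1] at hu
      exact not_transcendental_algebraMap a hu
    obtain ⟨uX, wX, hX, hXe⟩ := Point.exists_eq_some hSne
    rw [hXe] at hS0
    have hpX : 1 < placeValuation V P uX := (specialize_some_eq_zero_iff P hX).mp hS0
    have huX := transcendental_of_one_lt hpX
    have hwb : placeRes V P w ≠ b := by
      have := (placeValuation_eq_one_iff P hop.le).mp hop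
      rwa [placeRes_sub P hwi hib, placeRes_algebraMap, sub_ne_zero] at this
    have hwn : placeRes V P w = V'.negY a b := hwres.resolve_left hwb
    rw [hRL, hXe, poleIdx_some_of_one_lt P hX hpX huX, specialize_some_of_le_one P h hpu, hnegR,
      if_pos (by rw [Affine.Point.some.injEq]; exact ⟨hres, hwn⟩)]
    -- `e_{X + R_L}(P) = ord_P(u - a) = e_X(P)`
    have hRn' : (V'.baseChange V.FunctionField).toAffine.Nonsingular
        (algebraMap k V.FunctionField a) ((V'.baseChange V.FunctionField).toAffine.negY
          (algebraMap k V.FunctionField a) (algebraMap k V.FunctionField b)) :=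
      (Affine.nonsingular_neg ..).mpr hRn
    have hunit' : placeValuation V P (2 * (V'.baseChange V.FunctionField).toAffine.negY
        (algebraMap k V.FunctionField a) (algebraMap k V.FunctionField b) +
        (V'.baseChange V.FunctionField).toAffine.a₁ * algebraMap k V.FunctionField a +
        (V'.baseChange V.FunctionField).toAffine.a₃) = 1 := by
      rw [← hunitR, ← Valuation.map_neg, Affine.negY]
      congr 1; ring
    have hord := ord_sub_of_eq_add_pole P h hRn' hX huX hS0 hia hunit' (by
      rw [← hXe, show (Affine.Point.some _ _ hRn' : (V'.baseChange V.FunctionField).toAffine.Point)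
        = -Affine.Point.some _ _ hRn from (Affine.Point.neg_some hRn).symm,
        add_comm (Affine.Point.some u w h), neg_add_cancel_left])
    have hord2 := ord_pointPullback P h hu (xF V' - algebraMap k V'.FunctionField a)
    rw [map_sub, pointPullback_xF, AlgHom.commutes, specialize_some_of_le_one P h hpu] at hord2
    have h1 : ord V' (specialize V V' P (.some u w h)) (xF V' - algebraMap k V'.FunctionField a)
        = 1 := by
      rw [specialize_some_of_le_one P h hpu]
      have hQ : V'.Nonsingular a (V'.negY a b) := (Affine.nonsingular_neg ..).mpr hR
      have : Affine.Point.some (placeRes V P u) (placeRes V P w)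
          ((Affine.equation_iff_nonsingular).mp (equation_placeRes h.left hpu)) =
          Affine.Point.some a (V'.negY a b) hQ := by
        rw [Affine.Point.some.injEq]; exact ⟨hres, hwn⟩
      rw [this, ← algebraMap_xSubC]
      exact ord_xSubC_eq_one hQ (by rw [Affine.negY_negY]; exact h2.symm)
    rw [specialize_some_of_le_one P h hpu] at h1
    rw [h1, mul_one] at hord2
    rw [← hord, ← hord2]
  · -- tangent type: `X + R_L` integral, `X(P) = R ≠ -R`
    rw [hRL, poleIdx_add_of_tangent P h hRn hpu hia hxlt htan, specialize_some_of_le_one P h hpu,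
      hnegR, if_neg, Nat.cast_zero]
    intro heq
    rw [Affine.Point.some.injEq] at heq
    have hunit : placeValuation V P (w - algebraMap k V.FunctionField (V'.negY a b)) = 1 := by
      rw [← htan, ← baseChange_negY_algebraMap, Affine.negY]
      congr 1; ring
    have := (placeValuation_eq_one_iff P hunit.le).mp hunit
    rw [placeRes_sub P hwi (placeValuation_algebraMap_le_one P _), placeRes_algebraMap,
      heq.2, sub_self] at this
    exact this rfl

/-- **Translation by a constant point not of order `2` preserves the polar degree**:
`d(X + R_L) = d(X)` for every `L`-point `X` and `R ∈ V'(k) ∖ V'[2]` (for non-constant `X`: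
`Σ_P ε_{X+R_L}(P) = Σ_{X(P) = -R} e_X(P) = D_X(-R) = D_X(O')` by the constancy of the fibre
degree; constant `X` directly). [folklore] -/
theorem polarDeg_add_constL [IsAlgClosed k]
    (X : (V'.baseChange V.FunctionField).toAffine.Point) {a b : k} (hR : V'.Nonsingular a b)
    (h2 : b ≠ V'.negY a b) :
    polarDeg V V' (X + constL V V' (.some a b hR)) = polarDeg V V' X := by
  classical
  have hRn : (V'.baseChange V.FunctionField).toAffine.Nonsingular (algebraMap k V.FunctionField a)
      (algebraMap k V.FunctionField b) :=
    (Affine.map_nonsingular V' (FaithfulSMul.algebraMap_injective k V.FunctionField) a b).mpr hR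
  have hRL : constL V V' (.some a b hR) = .some _ _ hRn := constL_some hR
  cases X with
  | zero =>
    rw [show (Affine.Point.zero : (V'.baseChange V.FunctionField).toAffine.Point) = 0 from rfl,
      zero_add, polarDeg_constL, polarDeg_zero]
  | some u w h =>
    by_cases hu : Transcendental k u
    · have key : ∀ P, (poleIdx V V' P (.some u w h + constL V V' (.some a b hR)) : ℤ) =
          if specialize V V' P (.some u w h) = -.some a b hR then
            (ramificationIdx V V' P h hu : ℤ) else 0 := fun P ↦ poleIdx_add_constL P h hu hR h2
      have h1 := finsum_poleIdx (V := V) (V' := V') (.some u w h + constL V V' (.some a b hR))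
      rw [finsum_congr key, ← cast_fibreDegree h hu, fibreDegree_eq_fibreDegree_zero h hu,
        ← polarDeg_some_of_transcendental h hu] at h1
      exact_mod_cast h1.symm
    · obtain ⟨c, hc⟩ := exists_algebraMap_eq_of_isAlgebraic' (F := V.FunctionField)
        (not_not.mp hu)
      rw [polarDeg_some_of_not_transcendental h hu]
      subst hc
      have hic := placeValuation_algebraMap_le_one (V := V)
      by_cases hca : c = a
      · subst hca
        rcases Affine.Y_eq_of_X_eq h.left hRn.left rfl with hw | hw
        · -- `X = R_L`: tangent type everywhere
          have h0 : ∀ P, (poleIdx V V' P (.some _ w h + constL V V' (.some c b hR)) : ℤ) = 0 := by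
            intro P
            rw [hRL, poleIdx_add_of_tangent P h hRn (hic P c) (hic P c)
              (by rw [sub_self, map_zero]; exact zero_lt_one) ?_, Nat.cast_zero]
            rw [hw, ← two_mul]
            exact placeValuation_two_mul_add_eq_one P h2
          have := finsum_poleIdx (V := V) (V' := V') (.some _ w h + constL V V' (.some c b hR))
          rw [finsum_congr h0, finsum_zero] at this
          exact_mod_cast this.symm
        · -- `X = -R_L`
          have : (.some _ w h : (V'.baseChange V.FunctionField).toAffine.Point) =
              -constL V V' (.some c b hR) := by
            rw [hRL, Affine.Point.neg_some, Affine.Point.some.injEq]; exact ⟨rfl, hw⟩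
          rw [this, neg_add_cancel, polarDeg_zero]
      · -- distinct reduced `x` everywhere
        have h0 : ∀ P, (poleIdx V V' P (.some _ w h + constL V V' (.some a b hR)) : ℤ) = 0 := by
          intro P
          rw [hRL, poleIdx_add_of_sub_eq_one P h hRn (hic P c) (hic P a) (by
            rw [← map_sub]; exact placeValuation_algebraMap P (sub_ne_zero.mpr hca)), Nat.cast_zero]
        have := finsum_poleIdx (V := V) (V' := V') (.some _ w h + constL V V' (.some a b hR))
        rw [finsum_congr h0, finsum_zero] at this
        exact_mod_cast this.symm

/-- **`d(-X) = d(X)`** (same `x`-coordinate, same poles, and `e` is determined by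
`v_P(x(X)) = exp 2e`). [folklore] -/
theorem polarDeg_neg [IsAlgClosed k] (X : (V'.baseChange V.FunctionField).toAffine.Point) :
    polarDeg V V' (-X) = polarDeg V V' X := by
  cases X with
  | zero => rfl
  | some u w h =>
    rw [Affine.Point.neg_some]
    by_cases hu : Transcendental k u
    · have e1 := cast_fibreDegree ((Affine.nonsingular_neg ..).mpr h) hu 0
      have e2 := cast_fibreDegree (V := V) (V' := V') h hu 0
      rw [polarDeg_some_of_transcendental _ hu, polarDeg_some_of_transcendental _ hu]
      suffices (fibreDegree V V' ((Affine.nonsingular_neg ..).mpr h) hu 0 : ℤ) =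
          fibreDegree V V' h hu 0 by exact_mod_cast this
      rw [e1, e2]
      refine finsum_congr fun P ↦ ?_
      simp only [specialize_some_eq_zero_iff]
      split_ifs with h1
      · have ha := (placeValuation_eq_exp_ramificationIdx P ((Affine.nonsingular_neg ..).mpr h) hu
          ((specialize_some_eq_zero_iff P _).mpr h1)).1
        rw [(placeValuation_eq_exp_ramificationIdx P h hu
          ((specialize_some_eq_zero_iff P _).mpr h1)).1, WithZero.exp_inj] at ha
        norm_cast at ha ⊢
        omega
      · rfl
    · rw [polarDeg_some_of_not_transcendental _ hu, polarDeg_some_of_not_transcendental _ hu]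

end Translation

section Parallelogram

variable {V : WeierstrassCurve.Affine k} [V.IsElliptic] {V' : WeierstrassCurve.Affine k}
  [V'.IsElliptic]

/-! ## Genericity: the auxiliary constant point -/

omit [V.IsElliptic] [V'.IsElliptic] in
/-- The points of `V'(k)` with a given `x`-coordinate form a finite set (at most two).
[folklore] -/
theorem Point.finite_setOf_x_eq (α : k) :
    {R : V'.Point | ∃ y h, R = Affine.Point.some α y h}.Finite := by
  by_cases hex : ∃ y₀, V'.Nonsingular α y₀
  · obtain ⟨y₀, h₀⟩ := hex
    refine (Set.toFinite {Affine.Point.some α y₀ h₀, -Affine.Point.some α y₀ h₀}).subset ?_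
    rintro R ⟨y, h, rfl⟩
    rcases Affine.Y_eq_of_X_eq h.left h₀.left rfl with hy | hy
    · left; subst hy; rfl
    · right; rw [Set.mem_singleton_iff, Affine.Point.neg_some]; subst hy; rfl
  · have : {R : V'.Point | ∃ y h, R = Affine.Point.some α y h} = ∅ := by
      ext R
      simp only [Set.mem_setOf_eq, Set.mem_empty_iff_false, iff_false]
      rintro ⟨y, h, rfl⟩
      exact hex ⟨y, h⟩
    rw [this]
    exact Set.finite_empty

/-- **The specialisation of `B + X` at a pole of `X`** has the `x`-residue of `B`.
[folklore] -/
theorem exists_specialize_add_of_pole (P : V.Point) {uX wX u₀ w₀ : V.FunctionField}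
    (hX : (V'.baseChange V.FunctionField).toAffine.Nonsingular uX wX)
    (hX0 : specialize V V' P (.some uX wX hX) = 0)
    (h₀ : (V'.baseChange V.FunctionField).toAffine.Nonsingular u₀ w₀)
    (hi₀ : placeValuation V P u₀ ≤ 1) :
    ∃ β h', specialize V V' P (.some u₀ w₀ h₀ + .some uX wX hX) =
      Affine.Point.some (placeRes V P u₀) β h' := by
  have hu1 : 1 < placeValuation V P uX := (specialize_some_eq_zero_iff P hX).mp hX0
  have huX := transcendental_of_one_lt hu1
  have hne : u₀ ≠ uX := fun h ↦ by rw [h] at hi₀; exact not_lt_of_ge hi₀ hu1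
  have hle := placeValuation_addX_sub_le P hX huX hX0 h₀.left hi₀
  have hlt : placeValuation V P ((V'.baseChange V.FunctionField).toAffine.addX u₀ uX
      ((V'.baseChange V.FunctionField).toAffine.slope u₀ uX w₀ wX) - u₀) < 1 :=
    hle.trans_lt (by
      rw [← WithZero.exp_zero, WithZero.exp_lt_exp]
      have := ramificationIdx_pos P hX huX
      omega)
  have hint : placeValuation V P ((V'.baseChange V.FunctionField).toAffine.addX u₀ uX
      ((V'.baseChange V.FunctionField).toAffine.slope u₀ uX w₀ wX)) ≤ 1 := by
    have := Valuation.map_add (placeValuation V P)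
      ((V'.baseChange V.FunctionField).toAffine.addX u₀ uX
        ((V'.baseChange V.FunctionField).toAffine.slope u₀ uX w₀ wX) - u₀) u₀
    rw [sub_add_cancel] at this
    exact this.trans (max_le hlt.le hi₀)
  have hx : placeRes V P ((V'.baseChange V.FunctionField).toAffine.addX u₀ uX
      ((V'.baseChange V.FunctionField).toAffine.slope u₀ uX w₀ wX)) = placeRes V P u₀ := by
    have h0 := (placeRes_eq_zero_iff P (hlt.le)).mpr hlt
    rwa [placeRes_sub P hint hi₀, sub_eq_zero] at h0
  rw [Affine.Point.add_of_X_ne hne, specialize_some_of_le_one P _ hint]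
  have hns := (Affine.equation_iff_nonsingular (W := V')).mp
    (equation_placeRes (Affine.nonsingular_add h₀ hX fun hxy ↦ hne hxy.left).left hint)
  rw [hx] at hns
  refine ⟨_, hns, ?_⟩
  rw [Affine.Point.some.injEq]
  exact ⟨hx, rfl⟩

omit [V.IsElliptic] [V'.IsElliptic] in
/-- `2 • Q = 0` for an affine point `Q = (α, β)` means `β = -β - a₁α - a₃`. [folklore] -/
theorem two_nsmul_some_eq_zero_iff {α β : k} (h : V'.Nonsingular α β) :
    2 • Affine.Point.some α β h = 0 ↔ β = V'.negY α β := by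
  rw [two_nsmul, add_eq_zero_iff_eq_neg, Affine.Point.neg_some, Affine.Point.some.injEq]
  exact ⟨fun h ↦ h.2, fun h ↦ ⟨rfl, h⟩⟩

/-- **Existence of a generic auxiliary point.** For non-constant affine `L`-points `A`, `B` of
`V'` there is `R = (a, b) ∈ V'(k) ∖ V'[2]` such that: (1) `B(P) ≠ -R` on the fibre of `A` over
`O'`; (2) at the finitely many places `P` where `A` is integral with `A(P) ∈ V'[2]`:
`x(R) ≠ x(A(P))` and `R ∉ {B(P), -B(P), A(P) - B(P)}`; (3) `R_L ∉ {A - B, -A - B}`. (Each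
condition excludes finitely many `R`, and `V'(k)` is infinite.) [folklore] -/
theorem exists_generic_point [IsAlgClosed k] {uA wA uB wB : V.FunctionField}
    (hA : (V'.baseChange V.FunctionField).toAffine.Nonsingular uA wA)
    (hB : (V'.baseChange V.FunctionField).toAffine.Nonsingular uB wB)
    (huA : Transcendental k uA) :
    ∃ (a b : k) (hR : V'.Nonsingular a b), b ≠ V'.negY a b ∧
      (∀ P, specialize V V' P (.some uA wA hA) = 0 →
        specialize V V' P (.some uB wB hB) ≠ -Affine.Point.some a b hR) ∧
      (∀ P, placeValuation V P uA ≤ 1 → 2 • specialize V V' P (.some uA wA hA) = 0 →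
        a ≠ placeRes V P uA ∧ Affine.Point.some a b hR ≠ specialize V V' P (.some uB wB hB) ∧
          Affine.Point.some a b hR ≠ -specialize V V' P (.some uB wB hB) ∧
          Affine.Point.some a b hR ≠
            specialize V V' P (.some uA wA hA) - specialize V V' P (.some uB wB hB)) ∧
      constL V V' (Affine.Point.some a b hR) ≠ .some uA wA hA - .some uB wB hB ∧
      constL V V' (Affine.Point.some a b hR) ≠ -.some uA wA hA - .some uB wB hB := by
  classical
  set A : (V'.baseChange V.FunctionField).toAffine.Point := .some uA wA hA with hAdef
  set B : (V'.baseChange V.FunctionField).toAffine.Point := .some uB wB hB with hBdef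
  -- the finitely many bad points
  set S0 : Set V'.Point := {R | 2 • R = 0} with hS0
  have fS0 : S0.Finite := finite_setOf_two_nsmul_eq (V' := V') 0
  set FA : Set V.Point := {P | specialize V V' P A = 0} with hFA
  have fFA : FA.Finite := finite_fibre_specialize hA huA 0
  set S1 : Set V'.Point := (fun P ↦ -specialize V V' P B) '' FA with hS1
  have fS1 : S1.Finite := fFA.image _
  set F2 : Set V.Point := {P | placeValuation V P uA ≤ 1 ∧ 2 • specialize V V' P A = 0} with hF2
  have fF2 : F2.Finite := by
    refine (fS0.biUnion (t := fun T ↦ {P | specialize V V' P A = T})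
      fun T _ ↦ finite_fibre_specialize hA huA T).subset ?_
    intro P hP
    simp only [Set.mem_iUnion, Set.mem_setOf_eq, exists_prop]
    exact ⟨_, hP.2, rfl⟩
  set S2 : Set V'.Point := ⋃ P ∈ F2, ({R | ∃ y h, R = Affine.Point.some (placeRes V P uA) y h} ∪
    {specialize V V' P B, -specialize V V' P B,
      specialize V V' P A - specialize V V' P B}) with hS2
  have fS2 : S2.Finite := fF2.biUnion fun P _ ↦
    (Point.finite_setOf_x_eq _).union (Set.toFinite _)
  set S3 : Set V'.Point := constL V V' ⁻¹' {A - B, -A - B} with hS3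
  have fS3 : S3.Finite := (Set.toFinite _).preimage constL_injective.injOn
  have fin : (S0 ∪ S1 ∪ S2 ∪ S3).Finite := ((fS0.union fS1).union fS2).union fS3
  haveI : Infinite V'.Point := WeierstrassCurve.infinite_point (V := V')
  obtain ⟨R, hR⟩ := fin.infinite_compl.nonempty
  simp only [Set.mem_compl_iff, Set.mem_union, not_or] at hR
  obtain ⟨⟨⟨hR0, hR1⟩, hR2⟩, hR3⟩ := hR
  -- `R` is affine and not `2`-torsion
  have hRne : R ≠ 0 := fun h ↦ hR0 (by rw [hS0, Set.mem_setOf_eq, h, nsmul_zero])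
  obtain ⟨a, b, hRab, rfl⟩ := Point.exists_eq_some hRne
  refine ⟨a, b, hRab, fun h ↦ hR0 ((two_nsmul_some_eq_zero_iff hRab).mpr h), ?_, ?_, ?_, ?_⟩
  · intro P hP heq
    exact hR1 ⟨P, hP, by simp only [heq, neg_neg]⟩
  · intro P hiA h2A
    have hP : P ∈ F2 := ⟨hiA, h2A⟩
    have hnot : Affine.Point.some a b hRab ∉ ({R | ∃ y h, R = Affine.Point.some (placeRes V P uA)
        y h} ∪ {specialize V V' P B, -specialize V V' P B,
          specialize V V' P A - specialize V V' P B} : Set V'.Point) := by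
      intro hmem
      exact hR2 (Set.mem_biUnion hP hmem)
    simp only [Set.mem_union, Set.mem_setOf_eq, Set.mem_insert_iff, Set.mem_singleton_iff,
      not_or] at hnot
    obtain ⟨hx, hQ, hnQ, hAQ⟩ := hnot
    refine ⟨fun ha ↦ hx ⟨b, ha ▸ hRab, by subst ha; rfl⟩, hQ, hnQ, hAQ⟩
  · intro h
    exact hR3 (by rw [hS3, Set.mem_preimage, h]; exact Set.mem_insert _ _)
  · intro h
    exact hR3 (by
      rw [hS3, Set.mem_preimage, h]; exact Set.mem_insert_of_mem _ (Set.mem_singleton _))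

/-! ## The parallelogram law -/

/-- **The parallelogram law for non-constant affine `L`-points**: `d(A + B) + d(A - B) =
2d(A) + 2d(B)`. Perturb `B` to `B' = B + R_L` by a generic constant point `R`
(`exists_generic_point`), apply the law under genericity hypotheses to `(A, B')`, and remove
`R` by the translation invariance of `d`. Silverman, *AEC*, Cor. III.6.3 (for isogenies).
[folklore] -/
theorem polarDeg_parallelogram_of_transcendental [IsAlgClosed k] {uA wA uB wB : V.FunctionField}
    (hA : (V'.baseChange V.FunctionField).toAffine.Nonsingular uA wA)
    (hB : (V'.baseChange V.FunctionField).toAffine.Nonsingular uB wB)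
    (huA : Transcendental k uA) (huB : Transcendental k uB) :
    (polarDeg V V' (.some uA wA hA + .some uB wB hB) : ℤ) +
        polarDeg V V' (.some uA wA hA - .some uB wB hB) =
      2 * polarDeg V V' (.some uA wA hA) + 2 * polarDeg V V' (.some uB wB hB) := by
  classical
  obtain ⟨a, b, hR, h2R, c1, c2, c3, c3'⟩ := exists_generic_point hA hB huA
  have hRn : (V'.baseChange V.FunctionField).toAffine.Nonsingular (algebraMap k V.FunctionField a)
      (algebraMap k V.FunctionField b) :=
    (Affine.map_nonsingular V' (FaithfulSMul.algebraMap_injective k V.FunctionField) a b).mpr hR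
  have hRL : constL V V' (.some a b hR) = .some _ _ hRn := constL_some hR
  have hia := placeValuation_algebraMap_le_one (V := V)
  -- `B' = B + R_L` is affine
  have hB'ne : (.some uB wB hB : (V'.baseChange V.FunctionField).toAffine.Point) +
      constL V V' (.some a b hR) ≠ 0 := by
    intro h0
    have := eq_neg_of_add_eq_zero_left h0
    rw [hRL, Affine.Point.neg_some, Affine.Point.some.injEq] at this
    rw [this.1] at huB
    exact not_transcendental_algebraMap a huB
  obtain ⟨uB', wB', hB', hB'e⟩ := Point.exists_eq_some hB'ne
  -- (3) `x(A) ≠ x(B')`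
  have hx : uA ≠ uB' := by
    intro heq
    rcases Affine.Y_eq_of_X_eq hA.left hB'.left heq with hw | hw
    · have hAB' : (Affine.Point.some uA wA hA : (V'.baseChange V.FunctionField).toAffine.Point) =
          Affine.Point.some uB' wB' hB' := by subst heq; subst hw; rfl
      exact c3 (by rw [hAB', ← hB'e, add_sub_cancel_left])
    · have hAB' : (Affine.Point.some uA wA hA : (V'.baseChange V.FunctionField).toAffine.Point) =
          -Affine.Point.some uB' wB' hB' := by
        rw [Affine.Point.neg_some]; subst heq; subst hw; rfl
      exact c3' (by rw [hAB', neg_neg, ← hB'e, add_sub_cancel_left])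
  -- (1) no common pole
  have h1 : ∀ P, ¬(specialize V V' P (.some uA wA hA) = 0 ∧
      specialize V V' P (.some uB' wB' hB') = 0) := by
    rintro P ⟨hA0, hB'0⟩
    have hp' : 1 < placeValuation V P uB' := (specialize_some_eq_zero_iff P hB').mp hB'0
    have key := poleIdx_add_constL P hB huB hR h2R
    rw [hB'e, poleIdx_some_of_one_lt P hB' hp' (transcendental_of_one_lt hp')] at key
    split_ifs at key with hBR
    · exact c1 P hA0 hBR
    · have := ramificationIdx_pos P hB' (transcendental_of_one_lt hp')
      omega
  -- (2) `B'(P) ∉ V'[2]` at common reduced `x`-coordinates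
  have h2 : ∀ P, placeValuation V P uA ≤ 1 → placeValuation V P uB' ≤ 1 →
      placeValuation V P (uA - uB') < 1 →
      placeValuation V P (2 * wB' + (V'.baseChange V.FunctionField).toAffine.a₁ * uB' +
        (V'.baseChange V.FunctionField).toAffine.a₃) = 1 := by
    intro P hiA hiB' hxlt
    by_contra hne1
    have hwB' := placeValuation_y_le_one hB'.left hiB'
    obtain ⟨ha₁, -, ha₃, -, -⟩ := placeValuation_baseChange_a_le_one (V' := V') P
    have h2le : placeValuation V P (2 : V.FunctionField) ≤ 1 := by
      exact_mod_cast Valuation.natCast_le_one (placeValuation V P) 2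
    have t1 : placeValuation V P (2 * wB') ≤ 1 := by rw [map_mul]; exact mul_le_one' h2le hwB'
    have t2 : placeValuation V P ((V'.baseChange V.FunctionField).toAffine.a₁ * uB') ≤ 1 := by
      rw [map_mul]; exact mul_le_one' ha₁ hiB'
    have t12 : placeValuation V P (2 * wB' + (V'.baseChange V.FunctionField).toAffine.a₁ * uB')
        ≤ 1 := (Valuation.map_add _ _ _).trans (max_le t1 t2)
    have hle : placeValuation V P (2 * wB' + (V'.baseChange V.FunctionField).toAffine.a₁ * uB' +
        (V'.baseChange V.FunctionField).toAffine.a₃) ≤ 1 :=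
      (Valuation.map_add _ _ _).trans (max_le t12 ha₃)
    have hlt := lt_of_le_of_ne hle hne1
    have hr0 := (placeRes_eq_zero_iff P hle).mpr hlt
    rw [placeRes_add P t12 ha₃, placeRes_add P t1 t2, placeRes_mul P h2le hwB',
      placeRes_mul P ha₁ hiB', baseChange_a₁, baseChange_a₃, placeRes_algebraMap,
      placeRes_algebraMap, show placeRes V P (2 : V.FunctionField) = 2 by
        rw [← map_ofNat (algebraMap k V.FunctionField) 2, placeRes_algebraMap]] at hr0
    have hβ : placeRes V P wB' = V'.negY (placeRes V P uB') (placeRes V P wB') := by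
      rw [Affine.negY]; linear_combination hr0
    have hxres : placeRes V P uA = placeRes V P uB' := by
      have := (placeRes_eq_zero_iff P (Valuation.map_sub_le _ hiA hiB')).mpr hxlt
      rwa [placeRes_sub P hiA hiB', sub_eq_zero] at this
    have hyres : placeRes V P wA = placeRes V P wB' := by
      rcases Affine.Y_eq_of_X_eq (equation_placeRes hA.left hiA) (equation_placeRes hB'.left hiB')
        hxres with h | h
      · exact h
      · rw [h]; exact hβ.symm
    have hspec : specialize V V' P (.some uA wA hA) = specialize V V' P (.some uB' wB' hB') := by
      rw [specialize_some_of_le_one P hA hiA, specialize_some_of_le_one P hB' hiB',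
        Affine.Point.some.injEq]
      exact ⟨hxres, hyres⟩
    have h2A : 2 • specialize V V' P (.some uA wA hA) = 0 := by
      rw [hspec, specialize_some_of_le_one P hB' hiB', two_nsmul_some_eq_zero_iff]
      exact hβ
    obtain ⟨hxa, hQ, hnQ, hAQ⟩ := c2 P hiA h2A
    by_cases hpB : 1 < placeValuation V P uB
    · -- `B` has a pole at `P`: `B'(P)` has `x`-coordinate `a`
      obtain ⟨β, hβ', hsp⟩ := exists_specialize_add_of_pole P hB
        ((specialize_some_eq_zero_iff P hB).mpr hpB) hRn (hia P a)
      rw [add_comm, ← hRL, hB'e, specialize_some_of_le_one P hB' hiB', Affine.Point.some.injEq,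
        placeRes_algebraMap] at hsp
      exact hxa (by rw [hxres, hsp.1])
    · push Not at hpB
      by_cases hxB : placeValuation V P (uB - algebraMap k V.FunctionField a) = 1
      · -- `B'(P) = B(P) + R`
        have hadd := specialize_add_of_sub_eq_one P hB hRn hpB (hia P a) hxB
        rw [← hRL, hB'e, specialize_constL] at hadd
        exact hAQ (by rw [hspec, hadd, add_sub_cancel_left])
      · -- `B(P) = ±R`
        have hxlt' : placeValuation V P (uB - algebraMap k V.FunctionField a) < 1 :=
          lt_of_le_of_ne (Valuation.map_sub_le _ hpB (hia P a)) hxB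
        have hresB : placeRes V P uB = a := by
          have := (placeRes_eq_zero_iff P (Valuation.map_sub_le _ hpB (hia P a))).mpr hxlt'
          rwa [placeRes_sub P hpB (hia P a), placeRes_algebraMap, sub_eq_zero] at this
        rcases Affine.Y_eq_of_X_eq (equation_placeRes hB.left hpB) hR.left hresB with hw | hw
        · refine hQ ?_
          rw [specialize_some_of_le_one P hB hpB, Affine.Point.some.injEq]
          exact ⟨hresB.symm, hw.symm⟩
        · refine hnQ ?_
          rw [specialize_some_of_le_one P hB hpB, Affine.Point.neg_some, Affine.Point.some.injEq]
          exact ⟨hresB.symm, by rw [hw, hresB, Affine.negY_negY]⟩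
  -- the law for `(A, B')`, and translation back
  have hgen := polarDeg_parallelogram_of_generic hA hB' hx h1 h2
  rw [← hB'e, ← add_assoc, polarDeg_add_constL _ hR h2R, polarDeg_add_constL _ hR h2R,
    show (Affine.Point.some uA wA hA : (V'.baseChange V.FunctionField).toAffine.Point) -
      (Affine.Point.some uB wB hB + constL V V' (Affine.Point.some a b hR)) =
      (Affine.Point.some uA wA hA - Affine.Point.some uB wB hB) +
        constL V V' (-Affine.Point.some a b hR) by
      rw [constL_neg, ← sub_eq_add_neg, sub_add_eq_sub_sub], Affine.Point.neg_some,
    polarDeg_add_constL _ ((Affine.nonsingular_neg ..).mpr hR)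
      (by rw [Affine.negY_negY]; exact h2R.symm)] at hgen
  exact hgen

/-- **The parallelogram law for the polar degree**: for `L`-points `A`, `B` of `V'` each of which
is `O` or affine non-constant, `d(A + B) + d(A - B) = 2d(A) + 2d(B)`. Applied to the generic
images of isogenies this is Silverman, *AEC*, Cor. III.6.3 (`deg` is a quadratic form).
[folklore] -/
theorem polarDeg_parallelogram [IsAlgClosed k]
    {A B : (V'.baseChange V.FunctionField).toAffine.Point}
    (hA : A = 0 ∨ ∃ u w h, A = .some u w h ∧ Transcendental k u)
    (hB : B = 0 ∨ ∃ u w h, B = .some u w h ∧ Transcendental k u) :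
    polarDeg V V' (A + B) + polarDeg V V' (A - B) = 2 * polarDeg V V' A + 2 * polarDeg V V' B := by
  rcases hA with rfl | ⟨uA, wA, hA, rfl, huA⟩
  · rw [zero_add, zero_sub, polarDeg_neg, polarDeg_zero]; ring
  rcases hB with rfl | ⟨uB, wB, hB, rfl, huB⟩
  · rw [add_zero, sub_zero, polarDeg_zero]; ring
  exact_mod_cast polarDeg_parallelogram_of_transcendental hA hB huA huB

end Parallelogram

end Literature.NumberTheory.EllipticCurves.WeierstrassFunctionField
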